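import Literature.MathematicalPhysics.QuantumFieldTheory.Balaban1983to89.B6QGQTestBumpsKLevelV1L3
import HarnessLib
import Literature.MathematicalPhysics.QuantumFieldTheory.Balaban1983to89.B6Prop27KLevelV1L3

/-!
# `Balaban1983to89.B6QGQCoerciveKLevelV1L3` — SUB-ROW G-F3′-L0∕L3 (every odd `L ≥ 3`; plan `lit-balaban-r03/G-F3L0-PLAN.md` §13, joint J12; design
`lit-balaban-r03/J12-BUDGET.md` v3): the lower bound (2.147) `γ₀·Σ_iΛ_i²v_i² ≤ ⟪Q*v, GQ*v⟫` of `B6QGQCoerciveKLevelV1L0` WITHOUT its hypothesis `4 ≤ ℓ` (`L ≥ 5`).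

statement-level skeleton of published theorems with citation tags; proofs where landed; nothing here is a claim about the Yang–Mills mass gap

T. Bałaban, *Propagators and renormalization transformations for lattice gauge theories. II*, Commun. Math. Phys. **96** (1984) 223–250
[Balaban1984PropagatorsII], (2.147) p. 248 «⟨B,(QGQ*)B⟩ ≥ γ₀‖B‖² with a positive constant γ₀ depending on d and L only» — for EVERY odd `L`.  The level-0
twin `B6QGQCoerciveKLevelV1L0` realises it with tents of radius `r = ⌊L^j/5⌋ ≥ 1`, i.e. for `L ≥ 5`.  THIS FILE re-derives the three places where `L ≥ 5`
entered, keeping every definition of the twin BY NAME (`bump`, `mass`, `nu`, `Phi`, …; joint J14):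
* §A–§B (energy side) the tent numerics and the homogeneity bounds through the mass coefficient `mc_i` of `B6QGQTestBumpsKLevelV1L3` (`m_i·(L^D)^j·L^j =
  mc_i·Στ·(Στ_⊥)^d`, `2L^j ≤ 3mc_i`; `Στ ≥ L^{2j}/200` and `Στ² ≤ L^{3j}/9` at every level `≥ 1` of every odd `L ≥ 3`): `gpart_hom` with
  `C_∇(d) = 2(1 + d/9)·8^{2d}·90000`, `qpart_hom` with `(9/2)b₁L^D`;
* §C–§D (dominance side) the budget for `L = 3`: same-level rows `≠ i` carry `≤ ½·m_i` (`same_level_sum_le`, from the total-weight identity), a row receives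
  `≤ 1` same-level leak of size `≤ ½` when `r = 0` (`B6QGQTestBumpsKLevelV1L3.card_rad_zero_leakers_le_one`) and `≤ 2` of size `≤ ¼` when `r ≥ 1`, so
  `E1 + E2 ≤ ¼ + ¼`; coarse rows: under (2.2) with `R·M̂ ≥ 3` only case-A bumps are seen (`caseA_of_coarse_pair_ne_zero`), the TWO coarse rows of a bump
  together carry `≤ (5/4)L^{−D}Λ_i²/m_i`-weight (`nu_coarse_sum_le`, the exact two-row sum `coarse_sum_le`), a coarse row sees `≤ L^D` bumps each of weight
  `≤ (5/4)L^{−D}Λ_fine² = (5/4)L^{−2}Λ_coarse²`; AM–GM with `θ = L^{D−1}` gives `E3 + E4 ≤ (5/8)L^{−1} + (5/8)L^{−1} ≤ 5/12`; hence **`dominance`**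
  `⟪QΦv, v⟫ ≥ (1/12)·ΣΛ_i²v_i²` for every odd `L ≥ 3`;
* §E–§F `energy_Phi_le` with `C_E′ = 4D(D+2)C_∇ + 4D·L^D·(9/2)b₁L^D` and **`qgq_coercive_kLevel`** with `γ₀ = (1/12)²/C_E′`, binders = the twin's with
  `(hℓ : 4 ≤ ℓ)` DROPPED and `(hRM : 2 ≤ R·M̂)` strengthened to `(hRM : 3 ≤ R·M̂)` (the consumer has `M̂ ≥ 8`, `R ≥ 2L²`).
`prop27_kLevel_unconditional` over the L3 twin of Proposition 2.7 is appended when `B6Prop27KLevelV1L3` (window chain, cure (B′)) lands.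
No `def … : Prop`, no new fact; standard axioms.  Unit `lit-balaban-r03` (B6 fold owner, r03 gen 37), 2026-08-27; referee ref-4.  NOT summit progress.
-/

namespace Literature.MathematicalPhysics.QuantumFieldTheory.Balaban1983to89.B6QGQCoerciveKLevelV1L3

open Literature.MathematicalPhysics.QuantumFieldTheory.Balaban1983to89.B6QGQTestBumpsKLevelV1 (Tsum Tsum_pos bdiff qgq_coercive_of_test_map energy_le
  inner_GE_self_nonneg)
open Literature.MathematicalPhysics.QuantumFieldTheory.Balaban1983to89.B6QGQCoerciveKLevelV1 (TT2 TT2_le Tsum_ge amgm_same)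
open Literature.MathematicalPhysics.QuantumFieldTheory.Balaban1983to89.B6QGQTestBumpsKLevelV1L0 (rad erad one_le_erad rad_le_erad ctr tauL tauL_nonneg tsumL tsumL_pos
  bump bumpFn bumpFn_nonneg five_mul_rad_le ctr_fit' pair_le pair_nonneg level_window witness_of_pair_ne_zero card_coarse_rows_le grad_sq_le qrow_sq_le qenergy_bump_le
  base_eq_src_of rad_eq_zero_of_lvl erad_eq_one_of_lvl one_le_lvl_of_not_mem sum_pair_level_le)
open Literature.MathematicalPhysics.QuantumFieldTheory.Balaban1983to89.B6QGQCoerciveKLevelV1L0 (tt2 tt2_le_erad tsumL_ge_erad tsumL_ge grad_bump_le mass nu nu_nonneg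
  wt_eq_of_lvl wt_succ same_level_block card_same_level_le Phi Phi_apply inner_QPhi Phi_eval bdiff_Phi QE_Phi hwup_of_globalBand)
open Literature.MathematicalPhysics.QuantumFieldTheory.Balaban1983to89.B6QGQTestBumpsKLevelV1L3 (mc mc_pos one_le_mc mc_le_pow mc_caseA_eq mass_eq_coeff mass_pos_all
  two_pow_le_three_mc partner_le_half partner_le_quarter card_rad_zero_leakers_le_one caseA_of_coarse_pair_ne_zero coarse_sum_le card_fine_seen_le')
open scoped InnerProductSpace
open LatticeFieldCalculus
open B6SectAOperatorsV1 (QE QsE BondIdx BondIdxSpace)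
open B6SectAVectorModelV1 (GE deltaAE)
open BalabanImbrieJaffe1984to88.BIJ85AxialPropagator411 (BondSpace)
open B5Eq118OneStroke (iterBlock)
open B6MultiLevelBoxOperator (N0)
open B6MultiLevelTorusOperatorL0 (TDomains)
open B6GlobalChartV1 (PV)
open B6GlobalChartV1L0 (domT)
open B6Prop27KLevelV1L0 (wt wt_pos)
open B6Ineq2142KLevelV1 (cQ cQ_pos)
open B6Ineq2142KLevelV1L0 (lvl lvl_le lvl_le_mK base)

noncomputable section

variable {d ℓ m K : ℕ} {hd : 1 ≤ d + 1} {hL : Odd (ℓ + 1) ∧ 1 < ℓ + 1}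
variable {Mh k R : ℕ} {P' : Fin (d + 1) → ℕ}
variable (hN : ∀ μ, N0 ℓ Mh k P' μ = (PV d ℓ m K hd hL).sitesPerDir 0) (D : TDomains d ℓ Mh k P' R) (hk : k ≤ m + K)

/-! ## §A  Tent numerics for every odd `L ≥ 3` -/

/-- **`Στ ≥ L^{2j}/200` AT EVERY LEVEL OF EVERY ODD `L ≥ 3`** (`r ≥ 1`: `L^j ≤ 10r` and `Στ ≥ r²/2`; `r = 0`: `L^j ≤ 4` and `Στ ≥ r̂²/2 = ½`).
[cite: Balaban1984PropagatorsII, (2.147) p.248, bookkeeping] -/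
theorem tsumL_ge_sq (i : BondIdx (domT hN D hk)) : ((((ℓ + 1) ^ (lvl hN D hk i) : ℕ) : ℝ)) ^ 2 / 200 ≤ tsumL hN D hk i := by
  have h1 := tsumL_ge hN D hk i
  have h2 := tsumL_ge_erad hN D hk i
  have hlt : (ℓ + 1) ^ (lvl hN D hk i) < 5 * rad hN D hk i + 5 := by unfold rad; omega
  have hS0 : (0 : ℝ) ≤ (((ℓ + 1) ^ (lvl hN D hk i) : ℕ) : ℝ) := Nat.cast_nonneg _
  by_cases hr : 1 ≤ rad hN D hk i
  · have h10 : (ℓ + 1) ^ (lvl hN D hk i) ≤ 10 * rad hN D hk i := by omega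
    have h10' : (((ℓ + 1) ^ (lvl hN D hk i) : ℕ) : ℝ) ≤ 10 * rad hN D hk i := by exact_mod_cast h10
    nlinarith
  · have hr0 : rad hN D hk i = 0 := by omega
    have hS4 : (((ℓ + 1) ^ (lvl hN D hk i) : ℕ) : ℝ) ≤ 4 := by exact_mod_cast (by omega : (ℓ + 1) ^ (lvl hN D hk i) ≤ 4)
    have he1 : (erad hN D hk i : ℝ) = 1 := by unfold erad; rw [hr0]; norm_num
    rw [he1] at h2
    nlinarith

/-- **`Στ² ≤ L^{3j}/9` AT EVERY LEVEL `≥ 1` OF EVERY ODD `L ≥ 3`** (`r ≥ 1`: `Στ² ≤ L^j·r² ≤ L^{3j}/25`; `r = 0`: `Στ² ≤ L^j·r̂² = L^j ≤ L^{3j}/9` as `L^j ≥ 3`).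
[cite: Balaban1984PropagatorsII, (2.147) p.248, bookkeeping] -/
theorem tt2_le' (i : BondIdx (domT hN D hk)) (hj : 1 ≤ lvl hN D hk i) :
    tt2 hN D hk i ≤ ((((ℓ + 1) ^ (lvl hN D hk i) : ℕ) : ℝ)) ^ 3 / 9 := by
  have h := tt2_le_erad hN D hk i
  have h5 : 5 * (rad hN D hk i : ℝ) ≤ (((ℓ + 1) ^ (lvl hN D hk i) : ℕ) : ℝ) := by exact_mod_cast five_mul_rad_le hN D hk i
  have hS3 : (3 : ℝ) ≤ (((ℓ + 1) ^ (lvl hN D hk i) : ℕ) : ℝ) := by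
    have hl : 3 ≤ ℓ + 1 := by obtain ⟨r, hr'⟩ := hL.1; have := hL.2; omega
    exact_mod_cast le_trans (by rw [pow_one]; exact hl) (Nat.pow_le_pow_right (by omega) hj)
  have hS0 : (0 : ℝ) ≤ (((ℓ + 1) ^ (lvl hN D hk i) : ℕ) : ℝ) := Nat.cast_nonneg _
  by_cases hr : 1 ≤ rad hN D hk i
  · have he : erad hN D hk i = rad hN D hk i := max_eq_left hr
    rw [he] at h
    have hr0 : (0 : ℝ) ≤ rad hN D hk i := Nat.cast_nonneg _
    have hr2 : (rad hN D hk i : ℝ) ^ 2 ≤ ((((ℓ + 1) ^ (lvl hN D hk i) : ℕ) : ℝ)) ^ 2 / 25 := by nlinarith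
    nlinarith
  · have hr0 : rad hN D hk i = 0 := by omega
    have he1 : (erad hN D hk i : ℝ) = 1 := by unfold erad; rw [hr0]; norm_num
    rw [he1, one_pow, mul_one] at h
    have hSS : (3 : ℝ) * 3 ≤ (((ℓ + 1) ^ (lvl hN D hk i) : ℕ) : ℝ) * (((ℓ + 1) ^ (lvl hN D hk i) : ℕ) : ℝ) := mul_le_mul hS3 hS3 (by norm_num) hS0
    have h9 : 9 * (((ℓ + 1) ^ (lvl hN D hk i) : ℕ) : ℝ) ≤ (((ℓ + 1) ^ (lvl hN D hk i) : ℕ) : ℝ) ^ 3 := by nlinarith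
    linarith

/-- **THE GRADIENT SUM IN MONOMIAL FORM FOR EVERY ODD `L ≥ 3`**: `Σ_fΣ_ν(Δ_νφ_i)² ≤ 2(1 + d/9)·L^j·(L^{3j})^d` at levels `≥ 1`.
[cite: Balaban1984PropagatorsII, (2.147) p.248, bookkeeping] -/
theorem grad_bump_le' (i : BondIdx (domT hN D hk)) (hj : 1 ≤ lvl hN D hk i) (hper : 2 ≤ (PV d ℓ m K hd hL).sitesPerDir (lvl hN D hk i)) :
    ∑ f : PBond (PV d ℓ m K hd hL) 0, ∑ ν : Fin (d + 1), bdiff (bump hN D hk i) ν f ^ 2 ≤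
      2 * (1 + (d : ℝ) / 9) * (((ℓ + 1 : ℕ) : ℝ)) ^ (lvl hN D hk i) * (((((ℓ + 1 : ℕ) : ℝ)) ^ (lvl hN D hk i)) ^ 3) ^ d := by
  set j := lvl hN D hk i
  set Sr : ℝ := (((ℓ + 1 : ℕ) : ℝ)) ^ j with hSr
  have hS1 : 1 ≤ Sr := one_le_pow₀ (by exact_mod_cast Nat.succ_le_succ (Nat.zero_le ℓ))
  have hS0 : 0 < Sr := lt_of_lt_of_le zero_lt_one hS1
  have hcast : ((((ℓ + 1) ^ j : ℕ)) : ℝ) = Sr := Nat.cast_pow _ _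
  have hG := grad_bump_le hN D hk i hper
  rw [hcast] at hG
  have hT2 : TT2 (ℓ := ℓ) j ≤ Sr ^ 3 := by have := TT2_le (ℓ := ℓ) j; rwa [hcast] at this
  have hT20 : 0 ≤ TT2 (ℓ := ℓ) j := Finset.sum_nonneg fun t _ => sq_nonneg _
  have ht2 : tt2 hN D hk i ≤ Sr ^ 3 / 9 := by have := tt2_le' hN D hk i hj; rwa [hcast] at this
  have ht20 : 0 ≤ tt2 hN D hk i := Finset.sum_nonneg fun t _ => sq_nonneg _
  have hA : Sr * TT2 (ℓ := ℓ) j ^ d ≤ Sr * (Sr ^ 3) ^ d :=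
    mul_le_mul_of_nonneg_left (pow_le_pow_left₀ hT20 hT2 d) hS0.le
  have hB : (d : ℝ) * (tt2 hN D hk i * Sr * TT2 (ℓ := ℓ) j ^ (d - 1)) ≤ (d : ℝ) / 9 * (Sr * (Sr ^ 3) ^ d) := by
    rcases Nat.eq_zero_or_pos d with hd0 | hdpos
    · subst hd0; simp
    · have h2 : TT2 (ℓ := ℓ) j ^ (d - 1) ≤ (Sr ^ 3) ^ (d - 1) := pow_le_pow_left₀ hT20 hT2 _
      have h3 : tt2 hN D hk i * Sr * TT2 (ℓ := ℓ) j ^ (d - 1) ≤ (Sr ^ 3 / 9) * Sr * (Sr ^ 3) ^ (d - 1) := by gcongr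
      have h4 : (Sr ^ 3 / 9) * Sr * (Sr ^ 3) ^ (d - 1) = (1 / 9) * (Sr * (Sr ^ 3) ^ d) := by
        obtain ⟨e, he⟩ := Nat.exists_eq_add_of_le hdpos
        rw [he, Nat.add_sub_cancel_left, pow_succ]; ring
      rw [h4] at h3
      have hd0 : (0 : ℝ) ≤ d := Nat.cast_nonneg _
      calc (d : ℝ) * (tt2 hN D hk i * Sr * TT2 (ℓ := ℓ) j ^ (d - 1)) ≤ (d : ℝ) * ((1 / 9) * (Sr * (Sr ^ 3) ^ d)) :=
            mul_le_mul_of_nonneg_left h3 hd0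
        _ = _ := by ring
  calc _ ≤ 2 * (Sr * TT2 (ℓ := ℓ) j ^ d + d * (tt2 hN D hk i * Sr * TT2 (ℓ := ℓ) j ^ (d - 1))) := hG
    _ ≤ 2 * (Sr * (Sr ^ 3) ^ d + (d : ℝ) / 9 * (Sr * (Sr ^ 3) ^ d)) := by linarith
    _ = _ := by ring

/-! ## §B  Homogeneity through the mass coefficient `mc_i` -/

/-- the gradient constant `C_∇(d) = 2(1 + d/9)·8^{2d}·90000` for every odd `L ≥ 3`. [cite: Balaban1984PropagatorsII, (2.147) p.248, bookkeeping ours] -/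
def Cgrad (d : ℕ) : ℝ := 2 * (1 + (d : ℝ) / 9) * 8 ^ (2 * d) * 90000

/-- **THE MASS IN PRODUCT FORM FOR EVERY ODD `L ≥ 3`**: `m_i·(L^D)^j·L^j = mc_i·Στ·(Στ_⊥)^d`. [cite: Balaban1984PropagatorsII, (2.147) p.248, bookkeeping] -/
theorem mass_mul (i : BondIdx (domT hN D hk)) (hper : 2 ≤ (PV d ℓ m K hd hL).sitesPerDir (lvl hN D hk i)) :
    QE (domT hN D hk) (bump hN D hk i) i * (((((ℓ + 1 : ℕ) : ℝ)) ^ (d + 1)) ^ (lvl hN D hk i) * (((ℓ + 1 : ℕ) : ℝ)) ^ (lvl hN D hk i)) =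
      mc hN D hk i * (tsumL hN D hk i * Tsum (ℓ := ℓ) (lvl hN D hk i) ^ d) := by
  rw [mass_eq_coeff hN D hk i hper]
  unfold cQ
  have ha : ((((ℓ + 1 : ℕ) : ℝ) ^ (d + 1)) ^ (lvl hN D hk i)) ≠ 0 := by positivity
  have hb : ((((ℓ + 1 : ℕ) : ℝ)) ^ (lvl hN D hk i)) ≠ 0 := by positivity
  field_simp

/-- `2L^j ≤ 3mc` in the real-power form. [cite: Balaban1984PropagatorsII, (2.147) p.248, bookkeeping] -/
theorem two_Sr_le_three_mc (i : BondIdx (domT hN D hk)) : 2 * (((ℓ + 1 : ℕ) : ℝ)) ^ (lvl hN D hk i) ≤ 3 * mc hN D hk i := by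
  have h := two_pow_le_three_mc hN D hk i
  rwa [Nat.cast_pow] at h

/-- **HOMOGENEITY OF THE `Q`-PART FOR EVERY ODD `L ≥ 3`**: `W_i·Σ_{i′}w_{i′}(Qφ_i)_{i′}² ≤ (9/2)·b₁·L^D·m_i²`.
[cite: Balaban1984PropagatorsII, (2.147) p.248, (2.16) p.225, bookkeeping] -/
theorem qpart_hom (hRM : 2 ≤ R * Mh) (hper : ∀ n, n ≤ k + 1 → 2 ≤ (PV d ℓ m K hd hL).sitesPerDir n)
    {cf b₁ : ℝ} (hcf : cf ≠ 0) (hb₁ : 0 ≤ b₁) {w : BondIdx (domT hN D hk) → ℝ}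
    (hwup : ∀ i', w i' ≤ b₁ * cf ^ 2 * (((ℓ + 1 : ℕ) : ℝ) ^ (d + 1)) ^ (lvl hN D hk i') / ((((ℓ + 1 : ℕ) : ℝ)) ^ (lvl hN D hk i')) ^ 2)
    (i : BondIdx (domT hN D hk)) :
    wt hN D hk cf i * ∑ i', w i' * QE (domT hN D hk) (bump hN D hk i) i' ^ 2 ≤
      (9 / 2 * b₁ * (((ℓ + 1 : ℕ) : ℝ)) ^ (d + 1)) * QE (domT hN D hk) (bump hN D hk i) i ^ 2 := by
  set j := lvl hN D hk i
  set Lr : ℝ := ((ℓ + 1 : ℕ) : ℝ)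
  set A : ℝ := (Lr ^ (d + 1)) ^ j with hA
  set Sr : ℝ := Lr ^ j with hSr
  set M : ℝ := tsumL hN D hk i * Tsum (ℓ := ℓ) j ^ d
  set mm : ℝ := QE (domT hN D hk) (bump hN D hk i) i
  have hA0 : 0 < A := by positivity
  have hS0 : 0 < Sr := by positivity
  have hq := qenergy_bump_le hN D hk hRM hper hb₁ hwup i
  have hmass := mass_mul hN D hk i (hper j (by have := lvl_le hN D hk i; omega))
  have h23 : 2 * Sr ≤ 3 * mc hN D hk i := two_Sr_le_three_mc hN D hk i
  have hmc0 := mc_pos hN D hk i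
  have hM0 : 0 ≤ M := mul_nonneg (Finset.sum_nonneg fun t _ => tauL_nonneg hN D hk i t) (pow_nonneg (Tsum_pos (ℓ := ℓ) j).le _)
  have hmm0 : 0 ≤ mm := pair_nonneg hN D hk i i
  have hwt : wt hN D hk cf i = Sr ^ 2 / cf ^ 2 * A⁻¹ := by unfold wt; rw [div_pow]
  rw [hwt]
  -- `A⁻¹M ≤ (3/2)·mm`
  have h1 : mm * (A * Sr) = mc hN D hk i * M := hmass
  have hAM : A⁻¹ * M ≤ 3 / 2 * mm := by
    have e : A⁻¹ * M = mm * Sr / mc hN D hk i := by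
      field_simp
      linarith [h1]
    rw [e, div_le_iff₀ hmc0]
    nlinarith
  have hAM0 : 0 ≤ A⁻¹ * M := mul_nonneg (inv_nonneg.2 hA0.le) hM0
  have hsq : (A⁻¹ * M) ^ 2 ≤ (3 / 2 * mm) ^ 2 := pow_le_pow_left₀ hAM0 hAM 2
  calc Sr ^ 2 / cf ^ 2 * A⁻¹ * ∑ i', w i' * QE (domT hN D hk) (bump hN D hk i) i' ^ 2
      ≤ Sr ^ 2 / cf ^ 2 * A⁻¹ * (2 * b₁ * cf ^ 2 * Lr ^ (d + 1) * (Sr ^ 2)⁻¹ * A⁻¹ * M ^ 2) :=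
        mul_le_mul_of_nonneg_left hq (by positivity)
    _ = 2 * b₁ * Lr ^ (d + 1) * (A⁻¹ * M) ^ 2 := by field_simp
    _ ≤ 2 * b₁ * Lr ^ (d + 1) * (3 / 2 * mm) ^ 2 := mul_le_mul_of_nonneg_left hsq (by positivity)
    _ = (9 / 2 * b₁ * Lr ^ (d + 1)) * mm ^ 2 := by ring

/-- **THE GRADIENT PART FOR A LEVEL-0 INDEX BOND** (`φ_i` = the indicator of the bond, `W_i·c_f² = 1`, `Σ(Δφ_i)² ≤ 2(d + 1)`, `m_i ≥ ½·8^{−d}`).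
[cite: Balaban1984PropagatorsII, (2.147) p.248, (2.20) p.226, bookkeeping] -/
theorem gpart_hom_of_lvl_eq_zero {cf : ℝ} (hcf : cf ≠ 0) (i : BondIdx (domT hN D hk)) (hj0 : lvl hN D hk i = 0)
    (hper : 2 ≤ (PV d ℓ m K hd hL).sitesPerDir (lvl hN D hk i)) :
    wt hN D hk cf i * (cf ^ 2 * ∑ f : PBond (PV d ℓ m K hd hL) 0, ∑ ν : Fin (d + 1), bdiff (bump hN D hk i) ν f ^ 2) ≤
      Cgrad d * QE (domT hN D hk) (bump hN D hk i) i ^ 2 := by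
  have hS : (((ℓ + 1) ^ (lvl hN D hk i) : ℕ) : ℝ) = 1 := by rw [hj0, pow_zero, Nat.cast_one]
  have hr : (rad hN D hk i : ℝ) = 0 := by rw [rad_eq_zero_of_lvl hN D hk i hj0, Nat.cast_zero]
  have he : (erad hN D hk i : ℝ) = 1 := by rw [erad_eq_one_of_lvl hN D hk i hj0, Nat.cast_one]
  -- a level-0 index bond is case A, so `mc = L^0 − r = 1`
  have hA : i.1.2.src ∈ (domT hN D hk).Om (lvl hN D hk i) := by
    by_contra hB; have := one_le_lvl_of_not_mem hN D hk i hB; omega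
  have hmc : mc hN D hk i = 1 := by rw [mc_caseA_eq hN D hk i hA, hS, hr]; norm_num
  have hwt : wt hN D hk cf i * cf ^ 2 = 1 := by
    unfold wt; rw [hj0, pow_zero, pow_zero, inv_one, mul_one, div_pow, one_pow, div_mul_cancel₀ _ (pow_ne_zero 2 hcf)]
  set G := ∑ f : PBond (PV d ℓ m K hd hL) 0, ∑ ν : Fin (d + 1), bdiff (bump hN D hk i) ν f ^ 2 with hGdef
  have hT2 : TT2 (ℓ := ℓ) (lvl hN D hk i) ≤ 1 := by
    have := TT2_le (ℓ := ℓ) (lvl hN D hk i); rw [hS, one_pow] at this; exact this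
  have hT20 : 0 ≤ TT2 (ℓ := ℓ) (lvl hN D hk i) := Finset.sum_nonneg fun t _ => sq_nonneg _
  have ht2 : tt2 hN D hk i ≤ 1 := by
    have := tt2_le_erad hN D hk i; rw [hS, he, one_pow, one_mul] at this; exact this
  have ht20 : 0 ≤ tt2 hN D hk i := Finset.sum_nonneg fun t _ => sq_nonneg _
  have hd0 : (0 : ℝ) ≤ d := Nat.cast_nonneg _
  have hG : G ≤ 2 * (1 + (d : ℝ)) := by
    have h := grad_bump_le hN D hk i hper
    rw [hS] at h
    have h2 : TT2 (ℓ := ℓ) (lvl hN D hk i) ^ (d - 1) ≤ 1 := pow_le_one₀ hT20 hT2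
    have h1 : TT2 (ℓ := ℓ) (lvl hN D hk i) ^ d ≤ 1 := pow_le_one₀ hT20 hT2
    have h3 : tt2 hN D hk i * 1 * TT2 (ℓ := ℓ) (lvl hN D hk i) ^ (d - 1) ≤ 1 := by
      rw [mul_one]
      calc _ ≤ (1 : ℝ) * 1 := mul_le_mul ht2 h2 (pow_nonneg hT20 _) zero_le_one
        _ = 1 := one_mul 1
    have h4 : (d : ℝ) * (tt2 hN D hk i * 1 * TT2 (ℓ := ℓ) (lvl hN D hk i) ^ (d - 1)) ≤ d * 1 := mul_le_mul_of_nonneg_left h3 hd0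
    calc G ≤ 2 * (1 * TT2 (ℓ := ℓ) (lvl hN D hk i) ^ d + d * (tt2 hN D hk i * 1 * TT2 (ℓ := ℓ) (lvl hN D hk i) ^ (d - 1))) := h
      _ ≤ 2 * (1 + (d : ℝ)) := by linarith
  -- the mass is at least `½·8^{−d}`
  have hmass := mass_mul hN D hk i hper
  simp only [hj0, pow_zero, mul_one, hmc, one_mul] at hmass
  have hts : (1 : ℝ) / 2 ≤ tsumL hN D hk i := by
    have := tsumL_ge_erad hN D hk i; rw [he, one_pow] at this; exact this
  have hTs : (1 : ℝ) / 8 ≤ Tsum (ℓ := ℓ) 0 := by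
    have := Tsum_ge (ℓ := ℓ) 0; rw [pow_zero, Nat.cast_one, one_pow] at this; exact this
  have hmm : 1 / 2 * (1 / 8) ^ d ≤ QE (domT hN D hk) (bump hN D hk i) i := by
    rw [hmass]
    exact mul_le_mul hts (pow_le_pow_left₀ (by norm_num) hTs d) (by positivity) (le_trans (by norm_num) hts)
  have hsq : (1 / 2 * (1 / 8) ^ d) ^ 2 ≤ QE (domT hN D hk) (bump hN D hk i) i ^ 2 := pow_le_pow_left₀ (by positivity) hmm 2
  have h8 : (8 : ℝ) ^ (2 * d) * ((1 / 8) ^ d) ^ 2 = 1 := by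
    rw [← pow_mul, mul_comm d 2, ← mul_pow]; norm_num
  have hC : Cgrad d * (1 / 2 * (1 / 8) ^ d) ^ 2 = 45000 * (1 + (d : ℝ) / 9) := by
    unfold Cgrad
    rw [mul_pow]
    calc 2 * (1 + (d : ℝ) / 9) * 8 ^ (2 * d) * 90000 * ((1 / 2) ^ 2 * ((1 / 8) ^ d) ^ 2)
        = 2 * (1 + (d : ℝ) / 9) * 90000 * (1 / 2) ^ 2 * ((8 : ℝ) ^ (2 * d) * ((1 / 8) ^ d) ^ 2) := by ring
      _ = 45000 * (1 + (d : ℝ) / 9) := by rw [h8]; ring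
  calc wt hN D hk cf i * (cf ^ 2 * G) = G := by rw [← mul_assoc, hwt, one_mul]
    _ ≤ 2 * (1 + (d : ℝ)) := hG
    _ ≤ 45000 * (1 + (d : ℝ) / 9) := by linarith
    _ = Cgrad d * (1 / 2 * (1 / 8) ^ d) ^ 2 := hC.symm
    _ ≤ Cgrad d * QE (domT hN D hk) (bump hN D hk i) i ^ 2 := mul_le_mul_of_nonneg_left hsq (by unfold Cgrad; positivity)

/-- **HOMOGENEITY OF THE GRADIENT PART FOR EVERY ODD `L ≥ 3`**: `W_i·c_f²·Σ_fΣ_ν(Δ_νφ_i)² ≤ C_∇(d)·m_i²`.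
[cite: Balaban1984PropagatorsII, (2.147) p.248, bookkeeping] -/
theorem gpart_hom {cf : ℝ} (hcf : cf ≠ 0) (i : BondIdx (domT hN D hk))
    (hper : 2 ≤ (PV d ℓ m K hd hL).sitesPerDir (lvl hN D hk i)) :
    wt hN D hk cf i * (cf ^ 2 * ∑ f : PBond (PV d ℓ m K hd hL) 0, ∑ ν : Fin (d + 1), bdiff (bump hN D hk i) ν f ^ 2) ≤
      Cgrad d * QE (domT hN D hk) (bump hN D hk i) i ^ 2 := by
  rcases Nat.eq_zero_or_pos (lvl hN D hk i) with hj0 | hj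
  · exact gpart_hom_of_lvl_eq_zero hN D hk hcf i hj0 hper
  set j := lvl hN D hk i
  set Lr : ℝ := ((ℓ + 1 : ℕ) : ℝ)
  set A : ℝ := (Lr ^ (d + 1)) ^ j with hA
  set Sr : ℝ := Lr ^ j with hSr
  set M : ℝ := tsumL hN D hk i * Tsum (ℓ := ℓ) j ^ d
  set mm : ℝ := QE (domT hN D hk) (bump hN D hk i) i
  set G := ∑ f : PBond (PV d ℓ m K hd hL) 0, ∑ ν : Fin (d + 1), bdiff (bump hN D hk i) ν f ^ 2
  have hA0 : 0 < A := by positivity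
  have hS0 : 0 < Sr := by positivity
  have hAS : A = Sr ^ (d + 1) := pow_right_comm _ _ _
  have hG := grad_bump_le' hN D hk i hj hper
  have hG0 : 0 ≤ G := Finset.sum_nonneg fun f _ => Finset.sum_nonneg fun ν _ => sq_nonneg _
  have hmass : mm * (A * Sr) = mc hN D hk i * M := mass_mul hN D hk i hper
  have h23 : 2 * Sr ≤ 3 * mc hN D hk i := two_Sr_le_three_mc hN D hk i
  -- lower bound for `M` and for `A·mm`
  have htsum : Sr ^ 2 / 200 ≤ tsumL hN D hk i := by have := tsumL_ge_sq hN D hk i; rwa [Nat.cast_pow] at this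
  have hTsum : Sr ^ 2 / 8 ≤ Tsum (ℓ := ℓ) j := by have := Tsum_ge (ℓ := ℓ) j; rwa [Nat.cast_pow] at this
  have hM : Sr ^ 2 / 200 * (Sr ^ 2 / 8) ^ d ≤ M :=
    mul_le_mul htsum (pow_le_pow_left₀ (by positivity) hTsum d) (by positivity) (le_trans (by positivity) htsum)
  have hM0 : 0 ≤ M := le_trans (by positivity) hM
  have hAm : (1 / 300) * Sr ^ 2 * (Sr ^ 2 / 8) ^ d ≤ A * mm := by
    -- `A·mm·Sr = mc·M ≥ (2Sr/3)·M`
    have h1 : (2 / 3 * Sr) * M ≤ A * mm * Sr := by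
      have : A * mm * Sr = mc hN D hk i * M := by rw [← hmass]; ring
      rw [this]; exact mul_le_mul_of_nonneg_right (by linarith) hM0
    have h2 : (2 / 3 * Sr) * (Sr ^ 2 / 200 * (Sr ^ 2 / 8) ^ d) ≤ (2 / 3 * Sr) * M := mul_le_mul_of_nonneg_left hM (by positivity)
    have h3 : (2 / 3 * Sr) * (Sr ^ 2 / 200 * (Sr ^ 2 / 8) ^ d) = ((1 / 300) * Sr ^ 2 * (Sr ^ 2 / 8) ^ d) * Sr := by ring
    rw [h3] at h2
    exact le_of_mul_le_mul_right (h2.trans h1) hS0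
  have hAm0 : 0 ≤ A * mm := le_trans (by positivity) hAm
  have hwt : wt hN D hk cf i * cf ^ 2 = Sr ^ 2 * A⁻¹ := by
    unfold wt; rw [div_pow]; field_simp; rw [hA, hSr]; ring
  have step1 : wt hN D hk cf i * (cf ^ 2 * G) ≤ Sr ^ 2 * A⁻¹ * (2 * (1 + (d : ℝ) / 9) * Sr * (Sr ^ 3) ^ d) := by
    rw [← mul_assoc, hwt]
    exact mul_le_mul_of_nonneg_left hG (by positivity)
  refine step1.trans ?_
  have step2 : Cgrad d * ((1 / 300) * Sr ^ 2 * (Sr ^ 2 / 8) ^ d) ^ 2 ≤ Cgrad d * (A * mm) ^ 2 :=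
    mul_le_mul_of_nonneg_left (pow_le_pow_left₀ (by positivity) hAm 2) (by unfold Cgrad; positivity)
  have step3 : Cgrad d * mm ^ 2 = Cgrad d * (A * mm) ^ 2 * (A⁻¹) ^ 2 := by field_simp
  rw [step3]
  refine le_trans ?_ (mul_le_mul_of_nonneg_right step2 (sq_nonneg _))
  rw [hAS]
  have hS' : Sr ≠ 0 := hS0.ne'
  have hL' : Lr ≠ 0 := by positivity
  unfold Cgrad
  rw [show (Sr ^ 2 / 8) ^ d = (Sr ^ 2) ^ d / 8 ^ d by rw [div_pow]]
  field_simp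
  simp only [hSr]
  apply le_of_eq
  ring

/-! ## §C  The weighted rows for every odd `L ≥ 3` -/

/-- `ν_i·m_i = Λ_i²`. [cite: Balaban1984PropagatorsII, (2.147) p.248, bookkeeping] -/
theorem nu_mul_mass (cf : ℝ) (i : BondIdx (domT hN D hk)) (hper : 2 ≤ (PV d ℓ m K hd hL).sitesPerDir (lvl hN D hk i)) :
    nu hN D hk cf i * mass hN D hk i = wt hN D hk cf i := by
  unfold nu; exact div_mul_cancel₀ _ (mass_pos_all hN D hk i hper).ne'

/-- **THE SAME-LEVEL ROWS `≠ i` CARRY AT MOST HALF THE MASS, FOR EVERY ODD `L ≥ 3`**: `Σ_{i′ ≠ i, j(i′) = j(i)} (Qφ_i)_{i′} ≤ m_i/2` (the total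
same-level weight is `≤ c_Q·L^j·Στ·(Στ_⊥)^d` and `2L^j ≤ 3mc_i`). [cite: Balaban1984PropagatorsII, (2.147) p.248, bookkeeping] -/
theorem same_level_sum_le (i : BondIdx (domT hN D hk)) (hper : 2 ≤ (PV d ℓ m K hd hL).sitesPerDir (lvl hN D hk i)) :
    ∑ i' ∈ Finset.univ.filter (fun i' : BondIdx (domT hN D hk) => lvl hN D hk i' = lvl hN D hk i ∧ i' ≠ i), QE (domT hN D hk) (bump hN D hk i) i' ≤
      (1 / 2) * QE (domT hN D hk) (bump hN D hk i) i := by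
  classical
  have htot := sum_pair_level_le hN D hk i hper
  have hmass := mass_eq_coeff hN D hk i hper
  have hsplit : ∑ i' ∈ Finset.univ.filter (fun i' : BondIdx (domT hN D hk) => lvl hN D hk i' = lvl hN D hk i), QE (domT hN D hk) (bump hN D hk i) i' =
      QE (domT hN D hk) (bump hN D hk i) i +
        ∑ i' ∈ Finset.univ.filter (fun i' : BondIdx (domT hN D hk) => lvl hN D hk i' = lvl hN D hk i ∧ i' ≠ i), QE (domT hN D hk) (bump hN D hk i) i' := by
    have hmem : i ∈ Finset.univ.filter (fun i' : BondIdx (domT hN D hk) => lvl hN D hk i' = lvl hN D hk i) := by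
      rw [Finset.mem_filter]; exact ⟨Finset.mem_univ _, rfl⟩
    rw [← Finset.add_sum_erase _ _ hmem]
    congr 1
    refine Finset.sum_congr ?_ fun _ _ => rfl
    ext i'; simp only [Finset.mem_erase, Finset.mem_filter, Finset.mem_univ, true_and]; tauto
  rw [hsplit, hmass] at htot
  rw [hmass]
  have h23 := two_pow_le_three_mc hN D hk i
  have hc := cQ_pos (d := d) (ℓ := ℓ) (lvl hN D hk i)
  have hM : 0 ≤ tsumL hN D hk i * Tsum (ℓ := ℓ) (lvl hN D hk i) ^ d :=
    mul_nonneg (Finset.sum_nonneg fun t _ => tauL_nonneg hN D hk i t) (pow_nonneg (Tsum_pos (ℓ := ℓ) _).le _)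
  have key : cQ (d := d) (ℓ := ℓ) (lvl hN D hk i) * ((((ℓ + 1) ^ (lvl hN D hk i)) : ℕ) : ℝ) * (tsumL hN D hk i * Tsum (ℓ := ℓ) (lvl hN D hk i) ^ d) ≤
      (3 / 2) * (cQ (d := d) (ℓ := ℓ) (lvl hN D hk i) * mc hN D hk i * tsumL hN D hk i * Tsum (ℓ := ℓ) (lvl hN D hk i) ^ d) := by
    have : ((((ℓ + 1) ^ (lvl hN D hk i)) : ℕ) : ℝ) ≤ (3 / 2) * mc hN D hk i := by linarith
    calc _ = ((((ℓ + 1) ^ (lvl hN D hk i)) : ℕ) : ℝ) * (cQ (d := d) (ℓ := ℓ) (lvl hN D hk i) * (tsumL hN D hk i * Tsum (ℓ := ℓ) (lvl hN D hk i) ^ d)) := by ring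
      _ ≤ (3 / 2) * mc hN D hk i * (cQ (d := d) (ℓ := ℓ) (lvl hN D hk i) * (tsumL hN D hk i * Tsum (ℓ := ℓ) (lvl hN D hk i) ^ d)) :=
          mul_le_mul_of_nonneg_right this (mul_nonneg hc.le hM)
      _ = _ := by ring
  linarith

/-- **A SAME-LEVEL PARTNER ROW, WEIGHTED, FOR EVERY ODD `L ≥ 3`**: `ν_i(Qφ_i)_{i′} ≤ Λ_i²/2` (`i′ ≠ i`, `j(i′) = j(i)`), and `≤ Λ_i²/4` when `1 ≤ r(i)`.
[cite: Balaban1984PropagatorsII, (2.147) p.248, bookkeeping] -/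
theorem nu_pair_same_le {cf : ℝ} (hcf : cf ≠ 0) (i i' : BondIdx (domT hN D hk))
    (hper : 2 ≤ (PV d ℓ m K hd hL).sitesPerDir (lvl hN D hk i)) (hj : lvl hN D hk i' = lvl hN D hk i) (hne : i' ≠ i) :
    nu hN D hk cf i * QE (domT hN D hk) (bump hN D hk i) i' ≤ wt hN D hk cf i / 2 ∧
      (1 ≤ rad hN D hk i → nu hN D hk cf i * QE (domT hN D hk) (bump hN D hk i) i' ≤ wt hN D hk cf i / 4) := by
  have hW := wt_pos hN D hk hcf i
  by_cases hc : QE (domT hN D hk) (bump hN D hk i) i' = 0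
  · rw [hc, mul_zero]; exact ⟨by positivity, fun _ => by positivity⟩
  have hblk := same_level_block hN D hk i i' hj hc
  have hdir : i'.1.2.dir = i.1.2.dir := (witness_of_pair_ne_zero hN D hk i i' hc).1
  have hper' : 2 ≤ (PV d ℓ m K hd hL).sitesPerDir (lvl hN D hk i') := by rw [hj]; exact hper
  have hν := nu_nonneg hN D hk hcf i
  have hm := nu_mul_mass hN D hk cf i hper
  unfold mass at hm
  constructor
  · have hp := (partner_le_half hN D hk i i' hper' hper hj hdir hne hblk).2
    calc nu hN D hk cf i * QE (domT hN D hk) (bump hN D hk i) i' ≤ nu hN D hk cf i * ((1 / 2) * QE (domT hN D hk) (bump hN D hk i) i) :=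
          mul_le_mul_of_nonneg_left hp hν
      _ = wt hN D hk cf i / 2 := by linear_combination (1 / 2) * hm
  · intro hr
    have hp := partner_le_quarter hN D hk i i' hr hper' hper hj hdir hne hblk
    calc nu hN D hk cf i * QE (domT hN D hk) (bump hN D hk i) i' ≤ nu hN D hk cf i * ((1 / 4) * QE (domT hN D hk) (bump hN D hk i) i) :=
          mul_le_mul_of_nonneg_left hp hν
      _ = wt hN D hk cf i / 4 := by linear_combination (1 / 4) * hm

/-- **THE TWO COARSE ROWS OF A BUMP, WEIGHTED, FOR EVERY ODD `L ≥ 3`** (`R·M̂ ≥ 3`): `ν_i·Σ_{j(i′) = j(i)+1}(Qφ_i)_{i′} ≤ (5/4)L^{−D}·Λ_i²`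
(case A: `mc_i = L^j − r ≥ (4/5)L^j` and the two-row sum; case B: no coarse row sees `φ_i`). [cite: Balaban1984PropagatorsII, (2.147) p.248, (2.2) p.224, bookkeeping] -/
theorem nu_coarse_sum_le (hRM : 3 ≤ R * Mh) (hper : ∀ n, n ≤ k + 1 → 2 ≤ (PV d ℓ m K hd hL).sitesPerDir n) {cf : ℝ} (hcf : cf ≠ 0)
    (i : BondIdx (domT hN D hk)) :
    nu hN D hk cf i * ∑ i' ∈ Finset.univ.filter (fun i' : BondIdx (domT hN D hk) => lvl hN D hk i' = lvl hN D hk i + 1), QE (domT hN D hk) (bump hN D hk i) i' ≤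
      (5 / 4) * ((((ℓ + 1 : ℕ) : ℝ)) ^ (d + 1))⁻¹ * wt hN D hk cf i := by
  classical
  have hW := wt_pos hN D hk hcf i
  have hν := nu_nonneg hN D hk hcf i
  by_cases hA : i.1.2.src ∈ (domT hN D hk).Om (lvl hN D hk i)
  · set j := lvl hN D hk i
    set Lr : ℝ := ((ℓ + 1 : ℕ) : ℝ)
    set A : ℝ := (Lr ^ (d + 1)) ^ j with hA'
    set Sr : ℝ := Lr ^ j with hSr
    set M : ℝ := tsumL hN D hk i * Tsum (ℓ := ℓ) j ^ d
    set r : ℝ := (rad hN D hk i : ℝ)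
    have hL0 : 0 < Lr := by positivity
    have hA0 : 0 < A := by positivity
    have hS0 : 0 < Sr := by positivity
    have hperi := hper j (by have := lvl_le hN D hk i; omega)
    have hmass : QE (domT hN D hk) (bump hN D hk i) i * (A * Sr) = mc hN D hk i * M := mass_mul hN D hk i hperi
    have hmc : mc hN D hk i = Sr - r := by rw [mc_caseA_eq hN D hk i hA, Nat.cast_pow]
    have h5 : 5 * r ≤ Sr := by
      have h' : ((5 * rad hN D hk i : ℕ) : ℝ) ≤ (((ℓ + 1) ^ j : ℕ) : ℝ) := by exact_mod_cast five_mul_rad_le hN D hk i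
      rw [Nat.cast_pow, Nat.cast_mul, show ((5 : ℕ) : ℝ) = 5 by norm_num] at h'
      exact h'
    have hM0 : 0 ≤ M := mul_nonneg (Finset.sum_nonneg fun t _ => tauL_nonneg hN D hk i t) (pow_nonneg (Tsum_pos (ℓ := ℓ) j).le _)
    -- the two-row sum `≤ c_Q^{(j+1)}·L^{j+1}·M = (A·L^D)⁻¹·M`
    have hsum := coarse_sum_le hN D hk hper i
    have hcQ : cQ (d := d) (ℓ := ℓ) (j + 1) * (((ℓ + 1) ^ (j + 1) : ℕ) : ℝ) = (A * Lr ^ (d + 1))⁻¹ := by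
      rw [B6QGQTestBumpsKLevelV1.cQ_mul_pow, pow_succ]
    have hsum' : ∑ i' ∈ Finset.univ.filter (fun i' : BondIdx (domT hN D hk) => lvl hN D hk i' = j + 1), QE (domT hN D hk) (bump hN D hk i) i' ≤
        (A * Lr ^ (d + 1))⁻¹ * M := by
      refine hsum.trans (le_of_eq ?_)
      rw [← hcQ]; ring
    -- `M ≤ (5/4)·A·m`
    have hMle : M ≤ (5 / 4) * A * QE (domT hN D hk) (bump hN D hk i) i := by
      rw [hmc] at hmass
      have h1 : Sr * M ≤ (5 / 4) * ((Sr - r) * M) := by nlinarith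
      rw [← hmass] at h1
      have h2 : Sr * M ≤ Sr * ((5 / 4) * A * QE (domT hN D hk) (bump hN D hk i) i) := h1.trans (le_of_eq (by ring))
      exact le_of_mul_le_mul_left h2 hS0
    calc nu hN D hk cf i * ∑ i' ∈ Finset.univ.filter (fun i' : BondIdx (domT hN D hk) => lvl hN D hk i' = j + 1), QE (domT hN D hk) (bump hN D hk i) i'
        ≤ nu hN D hk cf i * ((A * Lr ^ (d + 1))⁻¹ * M) := mul_le_mul_of_nonneg_left hsum' hν
      _ ≤ nu hN D hk cf i * ((A * Lr ^ (d + 1))⁻¹ * ((5 / 4) * A * QE (domT hN D hk) (bump hN D hk i) i)) :=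
          mul_le_mul_of_nonneg_left (mul_le_mul_of_nonneg_left hMle (by positivity)) hν
      _ = (5 / 4) * (Lr ^ (d + 1))⁻¹ * (nu hN D hk cf i * mass hN D hk i) := by unfold mass; field_simp
      _ = _ := by rw [nu_mul_mass hN D hk cf i hperi]
  · -- case B: every coarse pairing vanishes
    have h0 : ∑ i' ∈ Finset.univ.filter (fun i' : BondIdx (domT hN D hk) => lvl hN D hk i' = lvl hN D hk i + 1), QE (domT hN D hk) (bump hN D hk i) i' = 0 := by
      refine Finset.sum_eq_zero fun i' hi' => ?_
      rw [Finset.mem_filter] at hi'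
      by_contra hne
      exact hA (caseA_of_coarse_pair_ne_zero hN D hk hRM i i' hi'.2 hne)
    rw [h0, mul_zero]; positivity

/-- **ONE COARSE ROW, WEIGHTED, FOR EVERY ODD `L ≥ 3`** (`R·M̂ ≥ 3`): `ν_i(Qφ_i)_{i′} ≤ (5/4)L^{−D}·Λ_i²` (`j(i′) = j(i) + 1`; case A by the twin's sup bound
and `mc_i = L^j − r`, case B trivially). [cite: Balaban1984PropagatorsII, (2.147) p.248, bookkeeping] -/
theorem nu_pair_coarse_le (hRM : 3 ≤ R * Mh) {cf : ℝ} (hcf : cf ≠ 0) (i i' : BondIdx (domT hN D hk))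
    (hper : 2 ≤ (PV d ℓ m K hd hL).sitesPerDir (lvl hN D hk i)) (hj : lvl hN D hk i' = lvl hN D hk i + 1) :
    nu hN D hk cf i * QE (domT hN D hk) (bump hN D hk i) i' ≤ (5 / 4) * ((((ℓ + 1 : ℕ) : ℝ)) ^ (d + 1))⁻¹ * wt hN D hk cf i := by
  have hW := wt_pos hN D hk hcf i
  have hν := nu_nonneg hN D hk hcf i
  by_cases hc : QE (domT hN D hk) (bump hN D hk i) i' = 0
  · rw [hc, mul_zero]; positivity
  have hA := caseA_of_coarse_pair_ne_zero hN D hk hRM i i' hj hc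
  set j := lvl hN D hk i
  set Lr : ℝ := ((ℓ + 1 : ℕ) : ℝ)
  set A : ℝ := (Lr ^ (d + 1)) ^ j with hA'
  set Sr : ℝ := Lr ^ j with hSr
  set M : ℝ := tsumL hN D hk i * Tsum (ℓ := ℓ) j ^ d
  set r : ℝ := (rad hN D hk i : ℝ)
  have hL0 : 0 < Lr := by positivity
  have hA0 : 0 < A := by positivity
  have hS0 : 0 < Sr := by positivity
  have hmass : QE (domT hN D hk) (bump hN D hk i) i * (A * Sr) = mc hN D hk i * M := mass_mul hN D hk i hper
  have hmc : mc hN D hk i = Sr - r := by rw [mc_caseA_eq hN D hk i hA, Nat.cast_pow]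
  rw [hmc] at hmass
  have h5 : 5 * r ≤ Sr := by
    have h' : ((5 * rad hN D hk i : ℕ) : ℝ) ≤ (((ℓ + 1) ^ j : ℕ) : ℝ) := by exact_mod_cast five_mul_rad_le hN D hk i
    rw [Nat.cast_pow, Nat.cast_mul, show ((5 : ℕ) : ℝ) = 5 by norm_num] at h'
    exact h'
  have hM0 : 0 ≤ M := mul_nonneg (Finset.sum_nonneg fun t _ => tauL_nonneg hN D hk i t) (pow_nonneg (Tsum_pos (ℓ := ℓ) j).le _)
  have hMle : M ≤ (5 / 4) * A * QE (domT hN D hk) (bump hN D hk i) i := by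
    have h1 : Sr * M ≤ (5 / 4) * ((Sr - r) * M) := by nlinarith
    rw [← hmass] at h1
    have h2 : Sr * M ≤ Sr * ((5 / 4) * A * QE (domT hN D hk) (bump hN D hk i) i) := h1.trans (le_of_eq (by ring))
    exact le_of_mul_le_mul_left h2 hS0
  have hcb := pair_le hN D hk i i'
  rw [abs_of_nonneg (pair_nonneg hN D hk i i'), hj, pow_succ] at hcb
  calc nu hN D hk cf i * QE (domT hN D hk) (bump hN D hk i) i'
      ≤ nu hN D hk cf i * ((A * Lr ^ (d + 1))⁻¹ * M) := mul_le_mul_of_nonneg_left hcb hν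
    _ ≤ nu hN D hk cf i * ((A * Lr ^ (d + 1))⁻¹ * ((5 / 4) * A * QE (domT hN D hk) (bump hN D hk i) i)) :=
        mul_le_mul_of_nonneg_left (mul_le_mul_of_nonneg_left hMle (by positivity)) hν
    _ = (5 / 4) * (Lr ^ (d + 1))⁻¹ * (nu hN D hk cf i * mass hN D hk i) := by unfold mass; field_simp
    _ = _ := by rw [nu_mul_mass hN D hk cf i hper]


/-! ## §D  The dominance bound for every odd `L ≥ 3`: `⟨QΦv, v⟩ ≥ (1/12)·Σ_iΛ_i²v_i²` -/

/-- the coarse AM–GM parameter `θ = L^{D−1}`. [cite: Balaban1984PropagatorsII, (2.147) p.248, bookkeeping ours] -/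
def theta (d ℓ : ℕ) : ℝ := (((ℓ + 1 : ℕ) : ℝ)) ^ d

/-- `θ > 0`. [cite: Balaban1984PropagatorsII, (2.147) p.248, bookkeeping] -/
theorem theta_pos (d ℓ : ℕ) : 0 < theta d ℓ := by unfold theta; positivity

/-- AM–GM with a parameter: `−(θ/2·x²a + y²a/(2θ)) ≤ x·a·y` for `a ≥ 0`, `θ > 0` (the coarse-row split of the dominance budget). [cite: Balaban1984PropagatorsII, (2.147) p.248, bookkeeping] -/
theorem amgm_theta (x y a θ : ℝ) (ha : 0 ≤ a) (hθ : 0 < θ) : -(θ / 2 * x ^ 2 * a + 1 / (2 * θ) * y ^ 2 * a) ≤ x * a * y := by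
  have e : x * a * y + (θ / 2 * x ^ 2 * a + 1 / (2 * θ) * y ^ 2 * a) = a * (θ * x + y) ^ 2 / (2 * θ) := by
    field_simp; ring
  have : 0 ≤ a * (θ * x + y) ^ 2 / (2 * θ) := by positivity
  linarith

/-- error density 1 (same level, own coordinate). [cite: Balaban1984PropagatorsII, (2.147) p.248, bookkeeping ours] -/
def E1 (cf : ℝ) (v : BondIdxSpace (domT hN D hk)) (i i' : BondIdx (domT hN D hk)) : ℝ :=
  if lvl hN D hk i' = lvl hN D hk i ∧ i' ≠ i then (1 / 2) * v i ^ 2 * (nu hN D hk cf i * QE (domT hN D hk) (bump hN D hk i) i') else 0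

/-- error density 2 (same level, partner coordinate). [cite: Balaban1984PropagatorsII, (2.147) p.248, bookkeeping ours] -/
def E2 (cf : ℝ) (v : BondIdxSpace (domT hN D hk)) (i i' : BondIdx (domT hN D hk)) : ℝ :=
  if lvl hN D hk i' = lvl hN D hk i ∧ i' ≠ i then (1 / 2) * v i' ^ 2 * (nu hN D hk cf i * QE (domT hN D hk) (bump hN D hk i) i') else 0

/-- error density 3 (coarse row, fine coordinate, weight `θ/2`). [cite: Balaban1984PropagatorsII, (2.147) p.248, bookkeeping ours] -/
def E3 (cf : ℝ) (v : BondIdxSpace (domT hN D hk)) (i i' : BondIdx (domT hN D hk)) : ℝ :=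
  if lvl hN D hk i' = lvl hN D hk i + 1 then theta d ℓ / 2 * v i ^ 2 * (nu hN D hk cf i * QE (domT hN D hk) (bump hN D hk i) i') else 0

/-- error density 4 (coarse row, coarse coordinate, weight `1/(2θ)`). [cite: Balaban1984PropagatorsII, (2.147) p.248, bookkeeping ours] -/
def E4 (cf : ℝ) (v : BondIdxSpace (domT hN D hk)) (i i' : BondIdx (domT hN D hk)) : ℝ :=
  if lvl hN D hk i' = lvl hN D hk i + 1 then 1 / (2 * theta d ℓ) * v i' ^ 2 * (nu hN D hk cf i * QE (domT hN D hk) (bump hN D hk i) i') else 0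

/-- the period hypothesis at the level of an index bond. [cite: Balaban1984PropagatorsII, (2.3) p.224, bookkeeping] -/
theorem hper_lvl (hper : ∀ n, n ≤ k + 1 → 2 ≤ (PV d ℓ m K hd hL).sitesPerDir n) (i : BondIdx (B6GlobalChartV1L0.domT hN D hk)) :
    2 ≤ (PV d ℓ m K hd hL).sitesPerDir (lvl hN D hk i) :=
  hper _ (by have := lvl_le hN D hk i; omega)

/-- `3 ≤ R·M̂` gives the twin's `2 ≤ R·M̂`. [cite: Balaban1984PropagatorsII, (2.2) p.224, bookkeeping] -/
theorem two_le_RMh (hRM : 3 ≤ R * Mh) : 2 ≤ R * Mh := le_trans (by norm_num) hRM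

/-- **THE POINTWISE LOWER BOUND** for the `(i, i′)` term of `⟨QΦv, v⟩`, for every odd `L ≥ 3`. [cite: Balaban1984PropagatorsII, (2.147) p.248, bookkeeping] -/
theorem term_lower (hRM : 3 ≤ R * Mh) (hper : ∀ n, n ≤ k + 1 → 2 ≤ (PV d ℓ m K hd hL).sitesPerDir n) {cf : ℝ} (hcf : cf ≠ 0)
    (v : BondIdxSpace (domT hN D hk)) (i i' : BondIdx (domT hN D hk)) :
    (if i' = i then wt hN D hk cf i * v i ^ 2 else 0) - E1 hN D hk cf v i i' - E2 hN D hk cf v i i' - E3 hN D hk cf v i i' - E4 hN D hk cf v i i' ≤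
      v i * nu hN D hk cf i * QE (domT hN D hk) (bump hN D hk i) i' * v i' := by
  have hperi := hper_lvl hN D hk hper i
  have hν0 := nu_nonneg hN D hk hcf i
  have hc0 := pair_nonneg hN D hk i i'
  have hθ := theta_pos d ℓ
  have ha0 : 0 ≤ nu hN D hk cf i * QE (domT hN D hk) (bump hN D hk i) i' := mul_nonneg hν0 hc0
  have h1n : 0 ≤ E1 hN D hk cf v i i' := by
    unfold E1; split_ifs
    · exact mul_nonneg (mul_nonneg (by norm_num) (sq_nonneg _)) ha0
    · exact le_rfl
  have h2n : 0 ≤ E2 hN D hk cf v i i' := by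
    unfold E2; split_ifs
    · exact mul_nonneg (mul_nonneg (by norm_num) (sq_nonneg _)) ha0
    · exact le_rfl
  have h3n : 0 ≤ E3 hN D hk cf v i i' := by
    unfold E3; split_ifs
    · exact mul_nonneg (mul_nonneg (by positivity) (sq_nonneg _)) ha0
    · exact le_rfl
  have h4n : 0 ≤ E4 hN D hk cf v i i' := by
    unfold E4; split_ifs
    · exact mul_nonneg (mul_nonneg (by positivity) (sq_nonneg _)) ha0
    · exact le_rfl
  by_cases hii : i' = i
  · subst hii
    rw [if_pos rfl]
    have e : v i' * nu hN D hk cf i' * QE (domT hN D hk) (bump hN D hk i') i' * v i' = wt hN D hk cf i' * v i' ^ 2 := by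
      have h := nu_mul_mass hN D hk cf i' hperi
      unfold mass at h
      linear_combination v i' ^ 2 * h
    rw [e]; linarith
  rw [if_neg hii]
  by_cases hj : lvl hN D hk i' = lvl hN D hk i
  · have e1 : E1 hN D hk cf v i i' = (1 / 2) * v i ^ 2 * (nu hN D hk cf i * QE (domT hN D hk) (bump hN D hk i) i') := by
      unfold E1; rw [if_pos ⟨hj, hii⟩]
    have e2 : E2 hN D hk cf v i i' = (1 / 2) * v i' ^ 2 * (nu hN D hk cf i * QE (domT hN D hk) (bump hN D hk i) i') := by
      unfold E2; rw [if_pos ⟨hj, hii⟩]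
    have h := amgm_same (v i) (v i') _ ha0
    rw [e1, e2]; nlinarith
  by_cases hj1 : lvl hN D hk i' = lvl hN D hk i + 1
  · have e3 : E3 hN D hk cf v i i' = theta d ℓ / 2 * v i ^ 2 * (nu hN D hk cf i * QE (domT hN D hk) (bump hN D hk i) i') := by
      unfold E3; rw [if_pos hj1]
    have e4 : E4 hN D hk cf v i i' = 1 / (2 * theta d ℓ) * v i' ^ 2 * (nu hN D hk cf i * QE (domT hN D hk) (bump hN D hk i) i') := by
      unfold E4; rw [if_pos hj1]
    have h := amgm_theta (v i) (v i') _ (theta d ℓ) ha0 hθ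
    rw [e3, e4]; nlinarith
  · have hcz : QE (domT hN D hk) (bump hN D hk i) i' = 0 := by
      by_contra hne
      have hw := level_window hN D hk (two_le_RMh hRM) i i' hne
      omega
    rw [hcz, mul_zero, zero_mul]; linarith

/-- `ΣΣE1 ≤ ¼ΣΛ²v²` for every odd `L ≥ 3`. [cite: Balaban1984PropagatorsII, (2.147) p.248, bookkeeping] -/
theorem sum_E1_le (hper : ∀ n, n ≤ k + 1 → 2 ≤ (PV d ℓ m K hd hL).sitesPerDir n) {cf : ℝ} (hcf : cf ≠ 0) (v : BondIdxSpace (domT hN D hk)) :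
    ∑ i, ∑ i', E1 hN D hk cf v i i' ≤ (1 / 4) * ∑ i, wt hN D hk cf i * v i ^ 2 := by
  classical
  rw [Finset.mul_sum]
  refine Finset.sum_le_sum fun i _ => ?_
  have hperi := hper_lvl hN D hk hper i
  unfold E1
  rw [← Finset.sum_filter]
  have h := same_level_sum_le hN D hk i hperi
  have hν0 := nu_nonneg hN D hk hcf i
  have hm := nu_mul_mass hN D hk cf i hperi
  unfold mass at hm
  rw [show ∑ i' ∈ Finset.univ.filter (fun i' => lvl hN D hk i' = lvl hN D hk i ∧ i' ≠ i),
      (1 / 2) * v i ^ 2 * (nu hN D hk cf i * QE (domT hN D hk) (bump hN D hk i) i') =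
      (1 / 2) * v i ^ 2 * nu hN D hk cf i * ∑ i' ∈ Finset.univ.filter (fun i' => lvl hN D hk i' = lvl hN D hk i ∧ i' ≠ i),
        QE (domT hN D hk) (bump hN D hk i) i' by rw [Finset.mul_sum]; exact Finset.sum_congr rfl fun _ _ => by ring]
  calc _ ≤ (1 / 2) * v i ^ 2 * nu hN D hk cf i * ((1 / 2) * QE (domT hN D hk) (bump hN D hk i) i) :=
        mul_le_mul_of_nonneg_left h (mul_nonneg (mul_nonneg (by norm_num) (sq_nonneg _)) hν0)
    _ = (1 / 4) * (wt hN D hk cf i * v i ^ 2) := by linear_combination (1 / 4) * v i ^ 2 * hm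

/-- `r` depends on the level only. [cite: Balaban1984PropagatorsII, (2.147) p.248, bookkeeping] -/
theorem rad_eq_of_lvl {i i' : BondIdx (B6GlobalChartV1L0.domT hN D hk)} (h : lvl hN D hk i = lvl hN D hk i') : rad hN D hk i = rad hN D hk i' := by
  show (ℓ + 1) ^ (lvl hN D hk i) / 5 = (ℓ + 1) ^ (lvl hN D hk i') / 5
  rw [h]

/-- `ΣΣE2 ≤ ¼ΣΛ²v²` for every odd `L ≥ 3` (`r ≥ 1`: at most two leaks of size `≤ ¼`; `r = 0`: at most one leak of size `≤ ½`).
[cite: Balaban1984PropagatorsII, (2.147) p.248, bookkeeping] -/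
theorem sum_E2_le (hper : ∀ n, n ≤ k + 1 → 2 ≤ (PV d ℓ m K hd hL).sitesPerDir n) {cf : ℝ} (hcf : cf ≠ 0) (v : BondIdxSpace (domT hN D hk)) :
    ∑ i, ∑ i', E2 hN D hk cf v i i' ≤ (1 / 4) * ∑ i, wt hN D hk cf i * v i ^ 2 := by
  classical
  rw [Finset.sum_comm, Finset.mul_sum]
  refine Finset.sum_le_sum fun i' _ => ?_
  have hW := wt_pos hN D hk hcf i'
  set c : ℝ := if 1 ≤ rad hN D hk i' then 1 / 4 else 1 / 2 with hcdef
  have hc0 : 0 ≤ c := by rw [hcdef]; split_ifs <;> norm_num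
  -- termwise bound
  have hb : ∀ i, E2 hN D hk cf v i i' ≤
      if lvl hN D hk i = lvl hN D hk i' ∧ i ≠ i' ∧ QE (domT hN D hk) (bump hN D hk i) i' ≠ 0 then (1 / 2) * v i' ^ 2 * (c * wt hN D hk cf i') else 0 := by
    intro i
    have hperi := hper_lvl hN D hk hper i
    unfold E2
    by_cases h1 : lvl hN D hk i' = lvl hN D hk i ∧ i' ≠ i
    · rw [if_pos h1]
      by_cases h2 : QE (domT hN D hk) (bump hN D hk i) i' = 0
      · rw [if_neg (fun h => h.2.2 h2), h2]; simp
      · rw [if_pos ⟨h1.1.symm, fun h => h1.2 h.symm, h2⟩]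
        have h := nu_pair_same_le hN D hk hcf i i' hperi h1.1 h1.2
        rw [← wt_eq_of_lvl hN D hk cf h1.1] at h
        have hrad : rad hN D hk i = rad hN D hk i' := rad_eq_of_lvl hN D hk h1.1.symm
        have hnn : 0 ≤ (1 / 2) * v i' ^ 2 := by positivity
        by_cases hr : 1 ≤ rad hN D hk i'
        · have hc : c = 1 / 4 := if_pos hr
          rw [hc]
          have := h.2 (by rw [hrad]; exact hr)
          exact mul_le_mul_of_nonneg_left (by linarith) hnn
        · have hc : c = 1 / 2 := if_neg hr
          rw [hc]
          exact mul_le_mul_of_nonneg_left (by linarith [h.1]) hnn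
    · rw [if_neg h1, if_neg (fun h => h1 ⟨h.1.symm, fun h' => h.2.1 h'.symm⟩)]
  refine (Finset.sum_le_sum fun i _ => hb i).trans ?_
  rw [← Finset.sum_filter, Finset.sum_const, nsmul_eq_mul]
  have hpos : 0 ≤ (1 / 2) * v i' ^ 2 * (c * wt hN D hk cf i') := by positivity
  have hWv : 0 ≤ wt hN D hk cf i' * v i' ^ 2 := by positivity
  by_cases hr : 1 ≤ rad hN D hk i'
  · have hc : c = 1 / 4 := if_pos hr
    have hcard : ((Finset.univ.filter (fun i => lvl hN D hk i = lvl hN D hk i' ∧ i ≠ i' ∧ QE (domT hN D hk) (bump hN D hk i) i' ≠ 0)).card : ℝ) ≤ 2 := by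
      exact_mod_cast card_same_level_le hN D hk i'
    rw [hc] at hpos ⊢
    nlinarith
  · have hc : c = 1 / 2 := if_neg hr
    have hr0 : rad hN D hk i' = 0 := by omega
    have hcard : ((Finset.univ.filter (fun i => lvl hN D hk i = lvl hN D hk i' ∧ i ≠ i' ∧ QE (domT hN D hk) (bump hN D hk i) i' ≠ 0)).card : ℝ) ≤ 1 := by
      have heq : Finset.univ.filter (fun i => lvl hN D hk i = lvl hN D hk i' ∧ i ≠ i' ∧ QE (domT hN D hk) (bump hN D hk i) i' ≠ 0) =
          Finset.univ.filter (fun i : BondIdx (domT hN D hk) =>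
            lvl hN D hk i = lvl hN D hk i' ∧ i ≠ i' ∧ rad hN D hk i = 0 ∧ QE (domT hN D hk) (bump hN D hk i) i' ≠ 0) := by
        refine Finset.filter_congr fun i _ => ⟨fun h => ⟨h.1, h.2.1, ?_, h.2.2⟩, fun h => ⟨h.1, h.2.1, h.2.2.2⟩⟩
        rw [rad_eq_of_lvl hN D hk h.1]; exact hr0
      rw [heq]; exact_mod_cast card_rad_zero_leakers_le_one hN D hk i' (hper_lvl hN D hk hper i')
    rw [hc] at hpos ⊢
    nlinarith

/-- `ΣΣE3 ≤ (5/8)L^{−1}·ΣΛ²v²` for every odd `L ≥ 3` (`R·M̂ ≥ 3`). [cite: Balaban1984PropagatorsII, (2.147) p.248, bookkeeping] -/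
theorem sum_E3_le (hRM : 3 ≤ R * Mh) (hper : ∀ n, n ≤ k + 1 → 2 ≤ (PV d ℓ m K hd hL).sitesPerDir n) {cf : ℝ} (hcf : cf ≠ 0)
    (v : BondIdxSpace (domT hN D hk)) :
    ∑ i, ∑ i', E3 hN D hk cf v i i' ≤ (5 / 8) * (((ℓ + 1 : ℕ) : ℝ))⁻¹ * ∑ i, wt hN D hk cf i * v i ^ 2 := by
  classical
  have hL0 : (0 : ℝ) < ((ℓ + 1 : ℕ) : ℝ) := by positivity
  rw [Finset.mul_sum]
  refine Finset.sum_le_sum fun i _ => ?_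
  unfold E3
  rw [← Finset.sum_filter]
  rw [show ∑ i' ∈ Finset.univ.filter (fun i' => lvl hN D hk i' = lvl hN D hk i + 1),
      theta d ℓ / 2 * v i ^ 2 * (nu hN D hk cf i * QE (domT hN D hk) (bump hN D hk i) i') =
      theta d ℓ / 2 * v i ^ 2 * (nu hN D hk cf i * ∑ i' ∈ Finset.univ.filter (fun i' => lvl hN D hk i' = lvl hN D hk i + 1),
        QE (domT hN D hk) (bump hN D hk i) i') by rw [Finset.mul_sum, Finset.mul_sum]]
  have h := nu_coarse_sum_le hN D hk hRM hper hcf i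
  have hθ := theta_pos d ℓ
  calc _ ≤ theta d ℓ / 2 * v i ^ 2 * ((5 / 4) * ((((ℓ + 1 : ℕ) : ℝ)) ^ (d + 1))⁻¹ * wt hN D hk cf i) :=
        mul_le_mul_of_nonneg_left h (by positivity)
    _ = (5 / 8) * (((ℓ + 1 : ℕ) : ℝ))⁻¹ * (wt hN D hk cf i * v i ^ 2) := by unfold theta; field_simp; ring

/-- `ΣΣE4 ≤ (5/8)L^{−1}·ΣΛ²v²` for every odd `L ≥ 3` (`R·M̂ ≥ 3`: a coarse row sees `≤ L^D` bumps, each of weight `≤ (5/4)L^{−2}Λ_coarse²`).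
[cite: Balaban1984PropagatorsII, (2.147) p.248, bookkeeping] -/
theorem sum_E4_le (hRM : 3 ≤ R * Mh) (hper : ∀ n, n ≤ k + 1 → 2 ≤ (PV d ℓ m K hd hL).sitesPerDir n) {cf : ℝ} (hcf : cf ≠ 0)
    (v : BondIdxSpace (domT hN D hk)) :
    ∑ i, ∑ i', E4 hN D hk cf v i i' ≤ (5 / 8) * (((ℓ + 1 : ℕ) : ℝ))⁻¹ * ∑ i, wt hN D hk cf i * v i ^ 2 := by
  classical
  set Lr : ℝ := ((ℓ + 1 : ℕ) : ℝ) with hLr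
  have hL0 : 0 < Lr := by positivity
  have hθ := theta_pos d ℓ
  rw [Finset.sum_comm, Finset.mul_sum]
  refine Finset.sum_le_sum fun i' _ => ?_
  have hW := wt_pos hN D hk hcf i'
  unfold E4
  have hb : ∀ i, (if lvl hN D hk i' = lvl hN D hk i + 1 then
      1 / (2 * theta d ℓ) * v i' ^ 2 * (nu hN D hk cf i * QE (domT hN D hk) (bump hN D hk i) i') else 0) ≤
      if lvl hN D hk i' = lvl hN D hk i + 1 ∧ QE (domT hN D hk) (bump hN D hk i) i' ≠ 0 then
        1 / (2 * theta d ℓ) * v i' ^ 2 * ((5 / 4) * (Lr ^ 2)⁻¹ * wt hN D hk cf i') else 0 := by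
    intro i
    have hperi := hper_lvl hN D hk hper i
    by_cases h1 : lvl hN D hk i' = lvl hN D hk i + 1
    · rw [if_pos h1]
      by_cases h2 : QE (domT hN D hk) (bump hN D hk i) i' = 0
      · rw [if_neg (fun h => h.2 h2), h2]; simp
      · rw [if_pos ⟨h1, h2⟩]
        have h := nu_pair_coarse_le hN D hk hRM hcf i i' hperi h1
        rw [wt_succ hN D hk cf h1] at h
        refine mul_le_mul_of_nonneg_left (h.trans (le_of_eq ?_)) (by positivity)
        rw [← hLr]; field_simp
    · rw [if_neg h1, if_neg (fun h => h1 h.1)]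
  refine (Finset.sum_le_sum fun i _ => hb i).trans ?_
  rw [← Finset.sum_filter, Finset.sum_const, nsmul_eq_mul]
  have hcard : ((Finset.univ.filter (fun i => lvl hN D hk i' = lvl hN D hk i + 1 ∧ QE (domT hN D hk) (bump hN D hk i) i' ≠ 0)).card : ℝ) ≤ Lr ^ (d + 1) := by
    have := (Nat.cast_le (α := ℝ)).2 (card_fine_seen_le' hN D hk hRM i')
    rw [hLr]; push_cast at this ⊢; exact this
  have hpos : 0 ≤ 1 / (2 * theta d ℓ) * v i' ^ 2 * ((5 / 4) * (Lr ^ 2)⁻¹ * wt hN D hk cf i') := by positivity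
  refine (mul_le_mul_of_nonneg_right hcard hpos).trans (le_of_eq ?_)
  unfold theta; rw [← hLr, pow_succ]; field_simp; ring

/-- **THE DOMINANCE BOUND FOR EVERY ODD `L ≥ 3`**: `⟨QΦv, v⟩ ≥ (1/12)·Σ_iΛ_i²v_i²` (`R·M̂ ≥ 3`; budget `¼ + ¼ + (5/8)L^{−1} + (5/8)L^{−1} ≤ 11/12`).
[cite: Balaban1984PropagatorsII, (2.147) p.248, bookkeeping] -/
theorem dominance (hRM : 3 ≤ R * Mh) (hper : ∀ n, n ≤ k + 1 → 2 ≤ (PV d ℓ m K hd hL).sitesPerDir n) {cf : ℝ} (hcf : cf ≠ 0)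
    (v : BondIdxSpace (domT hN D hk)) :
    (1 / 12) * ∑ i, wt hN D hk cf i * v i ^ 2 ≤ ⟪QE (domT hN D hk) (Phi hN D hk cf v), v⟫_ℝ := by
  classical
  rw [inner_QPhi]
  have hsum := Finset.sum_le_sum fun i (_ : i ∈ Finset.univ) => Finset.sum_le_sum fun i' (_ : i' ∈ Finset.univ) =>
    term_lower hN D hk hRM hper hcf v i i'
  refine le_trans ?_ hsum
  simp only [Finset.sum_sub_distrib]
  rw [Finset.sum_congr rfl fun i _ => Finset.sum_ite_eq' Finset.univ i (fun _ => wt hN D hk cf i * v i ^ 2)]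
  simp only [Finset.mem_univ, if_true]
  have h1 := sum_E1_le hN D hk hper hcf v
  have h2 := sum_E2_le hN D hk hper hcf v
  have h3 := sum_E3_le hN D hk hRM hper hcf v
  have h4 := sum_E4_le hN D hk hRM hper hcf v
  have hS0 : 0 ≤ ∑ i, wt hN D hk cf i * v i ^ 2 := Finset.sum_nonneg fun i _ => mul_nonneg (wt_pos hN D hk hcf i).le (sq_nonneg _)
  have hL3 : (3 : ℝ) ≤ ((ℓ + 1 : ℕ) : ℝ) := by
    have hl : 3 ≤ ℓ + 1 := by obtain ⟨r, hr'⟩ := hL.1; have := hL.2; omega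
    exact_mod_cast hl
  have hLinv : (((ℓ + 1 : ℕ) : ℝ))⁻¹ ≤ 3⁻¹ := inv_anti₀ (by norm_num) hL3
  have h5 := mul_le_mul_of_nonneg_right hLinv hS0
  nlinarith

/-! ## §E  The energy of `Φv` for every odd `L ≥ 3` -/

/-- the energy constant `C_E′(d, L, b₁) = 4D(D+2)·C_∇(d) + 4D·L^D·(9/2)b₁L^D`. [cite: Balaban1984PropagatorsII, (2.147) p.248, bookkeeping ours] -/
def Cen (d ℓ : ℕ) (b₁ : ℝ) : ℝ :=
  4 * ((d : ℝ) + 1) * (((d : ℝ) + 1) + 2) * Cgrad d +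
    4 * ((d : ℝ) + 1) * (((ℓ + 1 : ℕ) : ℝ)) ^ (d + 1) * ((9 / 2) * b₁ * (((ℓ + 1 : ℕ) : ℝ)) ^ (d + 1))

/-- `C_E′ > 0` for `b₁ ≥ 0`. [cite: Balaban1984PropagatorsII, (2.147) p.248, bookkeeping] -/
theorem Cen_pos (d ℓ : ℕ) {b₁ : ℝ} (hb₁ : 0 ≤ b₁) : 0 < Cen d ℓ b₁ := by
  unfold Cen Cgrad; positivity

/-- `ν_i²·c_f²·G_i ≤ C_∇·Λ_i²`. [cite: Balaban1984PropagatorsII, (2.147) p.248, bookkeeping] -/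
theorem nu_sq_grad_le (hper : ∀ n, n ≤ k + 1 → 2 ≤ (PV d ℓ m K hd hL).sitesPerDir n) {cf : ℝ} (hcf : cf ≠ 0) (i : BondIdx (domT hN D hk)) :
    nu hN D hk cf i ^ 2 * (cf ^ 2 * ∑ f : PBond (PV d ℓ m K hd hL) 0, ∑ ν : Fin (d + 1), bdiff (bump hN D hk i) ν f ^ 2) ≤
      Cgrad d * wt hN D hk cf i := by
  have hperi := hper_lvl hN D hk hper i
  have h := gpart_hom hN D hk hcf i hperi
  have hm := mass_pos_all hN D hk i hperi
  have hW := wt_pos hN D hk hcf i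
  have hG : 0 ≤ cf ^ 2 * ∑ f : PBond (PV d ℓ m K hd hL) 0, ∑ ν : Fin (d + 1), bdiff (bump hN D hk i) ν f ^ 2 :=
    mul_nonneg (sq_nonneg _) (Finset.sum_nonneg fun _ _ => Finset.sum_nonneg fun _ _ => sq_nonneg _)
  unfold nu mass
  rw [div_pow, div_mul_eq_mul_div, div_le_iff₀ (by positivity)]
  calc wt hN D hk cf i ^ 2 * (cf ^ 2 * ∑ f : PBond (PV d ℓ m K hd hL) 0, ∑ ν : Fin (d + 1), bdiff (bump hN D hk i) ν f ^ 2)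
      = wt hN D hk cf i * (wt hN D hk cf i * (cf ^ 2 * ∑ f : PBond (PV d ℓ m K hd hL) 0, ∑ ν : Fin (d + 1), bdiff (bump hN D hk i) ν f ^ 2)) := by ring
    _ ≤ wt hN D hk cf i * (Cgrad d * QE (domT hN D hk) (bump hN D hk i) i ^ 2) := mul_le_mul_of_nonneg_left h hW.le
    _ = _ := by ring

/-- `ν_i²·Q_i ≤ (9/2)b₁L^D·Λ_i²`. [cite: Balaban1984PropagatorsII, (2.147) p.248, bookkeeping] -/
theorem nu_sq_q_le (hRM : 3 ≤ R * Mh) (hper : ∀ n, n ≤ k + 1 → 2 ≤ (PV d ℓ m K hd hL).sitesPerDir n) {cf : ℝ} (hcf : cf ≠ 0)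
    {b₁ : ℝ} (hb₁ : 0 ≤ b₁) {w : BondIdx (domT hN D hk) → ℝ}
    (hwup : ∀ i', w i' ≤ b₁ * cf ^ 2 * (((ℓ + 1 : ℕ) : ℝ) ^ (d + 1)) ^ (lvl hN D hk i') / ((((ℓ + 1 : ℕ) : ℝ)) ^ (lvl hN D hk i')) ^ 2)
    (i : BondIdx (domT hN D hk)) :
    nu hN D hk cf i ^ 2 * ∑ i', w i' * QE (domT hN D hk) (bump hN D hk i) i' ^ 2 ≤
      ((9 / 2) * b₁ * (((ℓ + 1 : ℕ) : ℝ)) ^ (d + 1)) * wt hN D hk cf i := by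
  have hperi := hper_lvl hN D hk hper i
  have h := qpart_hom hN D hk (two_le_RMh hRM) hper hcf hb₁ hwup i
  have hm := mass_pos_all hN D hk i hperi
  have hW := wt_pos hN D hk hcf i
  unfold nu mass
  rw [div_pow, div_mul_eq_mul_div, div_le_iff₀ (by positivity)]
  calc wt hN D hk cf i ^ 2 * ∑ i', w i' * QE (domT hN D hk) (bump hN D hk i) i' ^ 2
      = wt hN D hk cf i * (wt hN D hk cf i * ∑ i', w i' * QE (domT hN D hk) (bump hN D hk i) i' ^ 2) := by ring
    _ ≤ wt hN D hk cf i * (((9 / 2) * b₁ * (((ℓ + 1 : ℕ) : ℝ)) ^ (d + 1)) * QE (domT hN D hk) (bump hN D hk i) i ^ 2) :=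
        mul_le_mul_of_nonneg_left h hW.le
    _ = _ := by ring

/-- **THE ENERGY OF THE TEST VECTOR FOR EVERY ODD `L ≥ 3`**: `⟨Φv, Δ_aΦv⟩ ≤ C_E′·Σ_iΛ_i²v_i²`.
[cite: Balaban1984PropagatorsII, (2.147) p.248, (2.16) p.225, bookkeeping] -/
theorem energy_Phi_le (hRM : 3 ≤ R * Mh) (hper : ∀ n, n ≤ k + 1 → 2 ≤ (PV d ℓ m K hd hL).sitesPerDir n) {cf : ℝ} (hcf : cf ≠ 0)
    {b₁ : ℝ} (hb₁ : 0 ≤ b₁) {w : BondIdx (domT hN D hk) → ℝ} (hw : ∀ i, 0 < w i)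
    (hwup : ∀ i', w i' ≤ b₁ * cf ^ 2 * (((ℓ + 1 : ℕ) : ℝ) ^ (d + 1)) ^ (lvl hN D hk i') / ((((ℓ + 1 : ℕ) : ℝ)) ^ (lvl hN D hk i')) ^ 2)
    (v : BondIdxSpace (domT hN D hk)) :
    ⟪Phi hN D hk cf v, deltaAE (domT hN D hk) cf w (Phi hN D hk cf v)⟫_ℝ ≤ Cen d ℓ b₁ * ∑ i, wt hN D hk cf i * v i ^ 2 := by
  have hE := energy_le (domT hN D hk) cf w (Phi hN D hk cf v)
  refine hE.trans ?_
  have hd2 : (((PV d ℓ m K hd hL).d : ℕ) : ℝ) = (d : ℝ) + 1 := by push_cast [show (PV d ℓ m K hd hL).d = d + 1 from rfl]; ring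
  rw [hd2]
  set a := fun i : BondIdx (domT hN D hk) => v i * nu hN D hk cf i with ha
  have hgrad : ∑ f : PBond (PV d ℓ m K hd hL) 0, ∑ ν : Fin (d + 1), bdiff (Phi hN D hk cf v) ν f ^ 2 ≤
      ∑ i, (4 * ((d : ℝ) + 1)) * (a i ^ 2 * ∑ f : PBond (PV d ℓ m K hd hL) 0, ∑ ν : Fin (d + 1), bdiff (bump hN D hk i) ν f ^ 2) := by
    calc ∑ f : PBond (PV d ℓ m K hd hL) 0, ∑ ν : Fin (d + 1), bdiff (Phi hN D hk cf v) ν f ^ 2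
        ≤ ∑ f : PBond (PV d ℓ m K hd hL) 0, ∑ ν : Fin (d + 1), ∑ i, (4 * ((d : ℝ) + 1)) * (a i * bdiff (bump hN D hk i) ν f) ^ 2 :=
          Finset.sum_le_sum fun f _ => Finset.sum_le_sum fun ν _ => by
            rw [bdiff_Phi, ← Finset.mul_sum]; exact grad_sq_le hN D hk a f ν
      _ = ∑ i, (4 * ((d : ℝ) + 1)) * (a i ^ 2 * ∑ f : PBond (PV d ℓ m K hd hL) 0, ∑ ν : Fin (d + 1), bdiff (bump hN D hk i) ν f ^ 2) := by
          rw [Finset.sum_congr rfl fun f _ => Finset.sum_comm, Finset.sum_comm]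
          refine Finset.sum_congr rfl fun i _ => ?_
          rw [Finset.mul_sum, Finset.mul_sum]
          refine Finset.sum_congr rfl fun f _ => ?_
          rw [Finset.mul_sum, Finset.mul_sum]
          exact Finset.sum_congr rfl fun ν _ => by ring
  have hq : ∑ i', w i' * QE (domT hN D hk) (Phi hN D hk cf v) i' ^ 2 ≤
      ∑ i, (4 * ((d : ℝ) + 1) * (((ℓ + 1 : ℕ) : ℝ)) ^ (d + 1)) * (a i ^ 2 * ∑ i', w i' * QE (domT hN D hk) (bump hN D hk i) i' ^ 2) := by
    calc ∑ i', w i' * QE (domT hN D hk) (Phi hN D hk cf v) i' ^ 2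
        ≤ ∑ i', ∑ i, w i' * ((4 * ((d : ℝ) + 1) * (((ℓ + 1 : ℕ) : ℝ)) ^ (d + 1)) * (a i * QE (domT hN D hk) (bump hN D hk i) i') ^ 2) :=
          Finset.sum_le_sum fun i' _ => by
            rw [QE_Phi, ← Finset.mul_sum, ← Finset.mul_sum]
            exact mul_le_mul_of_nonneg_left (qrow_sq_le hN D hk (two_le_RMh hRM) a i') (hw i').le
      _ = _ := by
          rw [Finset.sum_comm]
          refine Finset.sum_congr rfl fun i _ => ?_
          rw [Finset.mul_sum, Finset.mul_sum]
          exact Finset.sum_congr rfl fun i' _ => by ring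
  have hG : ∀ i, cf ^ 2 * (((d : ℝ) + 1) + 2) * ((4 * ((d : ℝ) + 1)) * (a i ^ 2 * ∑ f : PBond (PV d ℓ m K hd hL) 0, ∑ ν : Fin (d + 1), bdiff (bump hN D hk i) ν f ^ 2)) ≤
      (4 * ((d : ℝ) + 1) * (((d : ℝ) + 1) + 2) * Cgrad d) * (wt hN D hk cf i * v i ^ 2) := by
    intro i
    have h := nu_sq_grad_le hN D hk hper hcf i
    have hv : 0 ≤ v i ^ 2 * (4 * ((d : ℝ) + 1) * (((d : ℝ) + 1) + 2)) := by positivity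
    calc _ = (v i ^ 2 * (4 * ((d : ℝ) + 1) * (((d : ℝ) + 1) + 2))) *
          (nu hN D hk cf i ^ 2 * (cf ^ 2 * ∑ f : PBond (PV d ℓ m K hd hL) 0, ∑ ν : Fin (d + 1), bdiff (bump hN D hk i) ν f ^ 2)) := by
            simp only [ha]; ring
      _ ≤ (v i ^ 2 * (4 * ((d : ℝ) + 1) * (((d : ℝ) + 1) + 2))) * (Cgrad d * wt hN D hk cf i) := mul_le_mul_of_nonneg_left h hv
      _ = _ := by ring
  have hQ : ∀ i, (4 * ((d : ℝ) + 1) * (((ℓ + 1 : ℕ) : ℝ)) ^ (d + 1)) * (a i ^ 2 * ∑ i', w i' * QE (domT hN D hk) (bump hN D hk i) i' ^ 2) ≤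
      (4 * ((d : ℝ) + 1) * (((ℓ + 1 : ℕ) : ℝ)) ^ (d + 1) * ((9 / 2) * b₁ * (((ℓ + 1 : ℕ) : ℝ)) ^ (d + 1))) * (wt hN D hk cf i * v i ^ 2) := by
    intro i
    have h := nu_sq_q_le hN D hk hRM hper hcf hb₁ hwup i
    have hv : 0 ≤ v i ^ 2 * (4 * ((d : ℝ) + 1) * (((ℓ + 1 : ℕ) : ℝ)) ^ (d + 1)) := by positivity
    calc _ = (v i ^ 2 * (4 * ((d : ℝ) + 1) * (((ℓ + 1 : ℕ) : ℝ)) ^ (d + 1))) *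
          (nu hN D hk cf i ^ 2 * ∑ i', w i' * QE (domT hN D hk) (bump hN D hk i) i' ^ 2) := by simp only [ha]; ring
      _ ≤ (v i ^ 2 * (4 * ((d : ℝ) + 1) * (((ℓ + 1 : ℕ) : ℝ)) ^ (d + 1))) * (((9 / 2) * b₁ * (((ℓ + 1 : ℕ) : ℝ)) ^ (d + 1)) * wt hN D hk cf i) :=
          mul_le_mul_of_nonneg_left h hv
      _ = _ := by ring
  have hc0 : 0 ≤ cf ^ 2 * (((d : ℝ) + 1) + 2) := by positivity
  calc cf ^ 2 * (((d : ℝ) + 1) + 2) * ∑ f : PBond (PV d ℓ m K hd hL) 0, ∑ ν : Fin (d + 1), bdiff (Phi hN D hk cf v) ν f ^ 2 +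
        ∑ i', w i' * QE (domT hN D hk) (Phi hN D hk cf v) i' ^ 2
      ≤ cf ^ 2 * (((d : ℝ) + 1) + 2) * ∑ i, (4 * ((d : ℝ) + 1)) * (a i ^ 2 * ∑ f : PBond (PV d ℓ m K hd hL) 0, ∑ ν : Fin (d + 1), bdiff (bump hN D hk i) ν f ^ 2) +
        ∑ i, (4 * ((d : ℝ) + 1) * (((ℓ + 1 : ℕ) : ℝ)) ^ (d + 1)) * (a i ^ 2 * ∑ i', w i' * QE (domT hN D hk) (bump hN D hk i) i' ^ 2) :=
        add_le_add (mul_le_mul_of_nonneg_left hgrad hc0) hq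
    _ = ∑ i, cf ^ 2 * (((d : ℝ) + 1) + 2) * ((4 * ((d : ℝ) + 1)) * (a i ^ 2 * ∑ f : PBond (PV d ℓ m K hd hL) 0, ∑ ν : Fin (d + 1), bdiff (bump hN D hk i) ν f ^ 2)) +
        ∑ i, (4 * ((d : ℝ) + 1) * (((ℓ + 1 : ℕ) : ℝ)) ^ (d + 1)) * (a i ^ 2 * ∑ i', w i' * QE (domT hN D hk) (bump hN D hk i) i' ^ 2) := by
        rw [Finset.mul_sum]
    _ ≤ ∑ i, (4 * ((d : ℝ) + 1) * (((d : ℝ) + 1) + 2) * Cgrad d) * (wt hN D hk cf i * v i ^ 2) +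
        ∑ i, (4 * ((d : ℝ) + 1) * (((ℓ + 1 : ℕ) : ℝ)) ^ (d + 1) * ((9 / 2) * b₁ * (((ℓ + 1 : ℕ) : ℝ)) ^ (d + 1))) * (wt hN D hk cf i * v i ^ 2) :=
        add_le_add (Finset.sum_le_sum fun i _ => hG i) (Finset.sum_le_sum fun i _ => hQ i)
    _ = Cen d ℓ b₁ * ∑ i, wt hN D hk cf i * v i ^ 2 := by
        unfold Cen; rw [← Finset.mul_sum, ← Finset.mul_sum]; ring

/-! ## §F  The global coercivity (2.147) for every odd `L ≥ 3` -/

/-- the coercivity constant `γ₀(d, L, b₁) = (1/12)²/C_E′` for every odd `L ≥ 3`. [cite: Balaban1984PropagatorsII, (2.147) p.248, bookkeeping ours] -/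
def gam0 (d ℓ : ℕ) (b₁ : ℝ) : ℝ := (1 / 12) ^ 2 / Cen d ℓ b₁

/-- `γ₀ > 0`. [cite: Balaban1984PropagatorsII, (2.147) p.248, bookkeeping] -/
theorem gam0_pos (d ℓ : ℕ) {b₁ : ℝ} (hb₁ : 0 ≤ b₁) : 0 < gam0 d ℓ b₁ := div_pos (by norm_num) (Cen_pos d ℓ hb₁)

/-- **THE GLOBAL LEVEL-WEIGHTED COERCIVITY (2.147) AT `k` LEVELS FOR EVERY ODD `L ≥ 3`**: on ROUTE V's torus with `Λ₀` admitted, for `R·M̂ ≥ 3` and weights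
`0 < w_i ≤ b₁c_f²(L^D)^{j}/(L^{j})²`, `γ₀·Σ_i Λ_i²v_i² ≤ ⟨Q*v, GQ*v⟩` with `γ₀ = γ₀(d, L, b₁)` INDEPENDENT OF `k` — the print's «⟨B,(QGQ*)B⟩ ≥ γ₀‖B‖² (2.147)
with a positive constant γ₀ depending on d and L only», now WITHOUT the twin's restriction `L ≥ 5` (binders: the twin's with `4 ≤ ℓ` dropped and `2 ≤ R·M̂`
replaced by `3 ≤ R·M̂`). [cite: Balaban1984PropagatorsII, (2.147) p.248] -/
theorem qgq_coercive_kLevel (hRM : 3 ≤ R * Mh) {cf : ℝ} (hcf : cf ≠ 0) {b₁ : ℝ} (hb₁ : 0 ≤ b₁)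
    {w : BondIdx (domT hN D hk) → ℝ} (hw : ∀ i, 0 < w i)
    (hwup : ∀ i', w i' ≤ b₁ * cf ^ 2 * (((ℓ + 1 : ℕ) : ℝ) ^ (d + 1)) ^ (lvl hN D hk i') / ((((ℓ + 1 : ℕ) : ℝ)) ^ (lvl hN D hk i')) ^ 2)
    (v : BondIdxSpace (domT hN D hk)) :
    gam0 d ℓ b₁ * ∑ i, wt hN D hk cf i * v i ^ 2 ≤ ⟪QsE (domT hN D hk) v, GE (domT hN D hk) hcf hw (QsE (domT hN D hk) v)⟫_ℝ :=
  qgq_coercive_of_test_map (domT hN D hk) hcf hw (Phi hN D hk cf) (fun v => ∑ i, wt hN D hk cf i * v i ^ 2)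
    (fun v => Finset.sum_nonneg fun i _ => mul_nonneg (wt_pos hN D hk hcf i).le (sq_nonneg _)) (by norm_num) (Cen_pos d ℓ hb₁)
    (dominance hN D hk hRM (fun n _ => Nat.succ_le_of_lt ((PV d ℓ m K hd hL).one_lt_sitesPerDir n)) hcf)
    (energy_Phi_le hN D hk hRM (fun n _ => Nat.succ_le_of_lt ((PV d ℓ m K hd hL).one_lt_sitesPerDir n)) hcf hb₁ hw hwup) v


/-! ## §G  Proposition 2.7 (2.149) for every odd `L ≥ 3` WITHOUT the coercivity hypothesis (v1.1, appended when `B6Prop27KLevelV1L3` landed) -/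

section Final

open B6SectAVectorModelV1 (EE)
open B6Geom246MultiLevelTorusL0 (geomT)
open B6RandomWalk (delta3)
open B6Prop27KLevelV1L0 (lam)
open B6Ineq2142KLevelV1L0 (β)
open B6CubeWindowV1 (GlobalBand)
open B6CubeWindowV1L3 (PlacedC)
open B6Cover236MultiLevelBlocksL0 (cubes)

/-- `R ≥ 2L²` and `M̂ ≥ 8` give `R·M̂ ≥ 3` (the (2.2) input of `qgq_coercive_kLevel` in the consumers' variables). [cite: Balaban1984PropagatorsII, (2.2) p.224, bookkeeping] -/
theorem three_le_RMh {ℓ R Mh : ℕ} (hR2 : 2 * (ℓ + 1) ^ 2 ≤ R) (hM8 : 8 ≤ Mh) : 3 ≤ R * Mh := by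
  have hR1 : 1 ≤ R := by
    have h1 : 1 ≤ (ℓ + 1) ^ 2 := Nat.one_le_pow _ _ (by omega)
    omega
  calc 3 ≤ 1 * 8 := by norm_num
    _ ≤ R * Mh := Nat.mul_le_mul hR1 hM8

/-- **PROPOSITION 2.7 (2.149) AT `k` LEVELS, UNCONDITIONAL, FOR EVERY ODD `L ≥ 3`**: `B6Prop27KLevelV1L3.prop27_kLevel` with its global coercivity hypothesis
DISCHARGED by `qgq_coercive_kLevel` (`γ = γ₀(d, L, b₁)`, k-uniform): on ROUTE V's torus with `Λ₀` admitted, for the standing side conditions of the k-level (2.142)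
at `L ≥ 3` (canonical chart, `PlacedC`), the kernel of `(QGQ*)⁻¹` decays exponentially in the scaled distance with k-uniform constants.
[cite: Balaban1984PropagatorsII, Proposition 2.7 (2.149) p.249] -/
theorem prop27_kLevel_unconditional (d ℓ : ℕ) (hd : 1 ≤ d + 1) (hL : Odd (ℓ + 1) ∧ 1 < ℓ + 1) {b₀ b₁ : ℝ} (hb₀ : 0 < b₀) (hb₁ : b₀ ≤ b₁) :
    ∃ σ₁ : ℝ, 0 < σ₁ ∧ ∀ (σ : ℝ), 0 < σ → σ ≤ σ₁ → ∀ (α : ℝ), 0 < α → α < 1 →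
    ∃ (A' M₂ c : ℝ) (N₁ : ℕ), 0 < A' ∧ 0 < M₂ ∧ 0 ≤ c ∧
    ∀ (m K : ℕ) {Mh k R : ℕ} {P' : Fin (d + 1) → ℕ}
      (hN : ∀ μ, N0 ℓ Mh k P' μ = (PV d ℓ m K hd hL).sitesPerDir 0) (D : B6MultiLevelTorusOperatorL0.TDomains d ℓ Mh k P' R) (hk : k ≤ m + K) (_ : 2 ≤ k)
      {a : ℕ} (_ : Mh = (ℓ + 1) ^ a) (_ : 8 ≤ Mh) (_ : 2 * (ℓ + 1) ^ 2 ≤ R) (_ : ∀ μ, 5 ≤ P' μ)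
      (_ : ∀ c : ↥(cubes D.toDomains), PlacedC ℓ k P' c.1) (_ : M₂ ≤ ((ℓ : ℝ) + 1) * Mh) (_ : N₁ + 1 ≤ R * ((ℓ + 1) * Mh))
      {cf : ℝ} (hcf : cf ≠ 0) {w : BondIdx (domT hN D hk) → ℝ} (hw : ∀ i, 0 < w i) (_ : GlobalBand b₀ b₁ cf w),
      ∀ i i' : BondIdx (domT hN D hk),
        |⟪EuclideanSpace.single i (1 : ℝ), EE (domT hN D hk) hcf hw (EuclideanSpace.single i' (1 : ℝ))⟫_ℝ| ≤
          (lam hN D hk cf i)⁻¹ * (lam hN D hk cf i')⁻¹ * (2 / gam0 d ℓ b₁ *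
            Real.exp (-(min (delta3 α (2 * σ) / 4) (gam0 d ℓ b₁ / A' / (2 * (1 * (4 / delta3 α (2 * σ)) * (2 * ((d : ℝ) + 1) * c)) + 1)) *
              (geomT D).dist (β hN D hk i) (β hN D hk i')))) := by
  obtain ⟨σ₁, hσ₁, h⟩ := B6Prop27KLevelV1L3.prop27_kLevel d ℓ hd hL hb₀ hb₁
  refine ⟨σ₁, hσ₁, fun σ hσ hσ1 α hα hα1 => ?_⟩
  obtain ⟨A', M₂, c, N₁, hA', hM₂, hc, hmain⟩ := h σ hσ hσ1 α hα hα1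
  refine ⟨A', M₂, c, N₁, hA', hM₂, hc, ?_⟩
  intro m K Mh k R P' hN D hk hk2 a hMh hMh8 hR hP' hPl hM₂' hN₁ cf hcf w hw hB i i'
  have hb₁0 : 0 ≤ b₁ := le_trans hb₀.le hb₁
  exact hmain m K hN D hk hk2 hMh hMh8 hR hP' hPl hM₂' hN₁ hcf hw hB (gam0_pos d ℓ hb₁0)
    (qgq_coercive_kLevel hN D hk (three_le_RMh hR hMh8) hcf hb₁0 hw (hwup_of_globalBand hN D hk hcf hB)) i i'

end Final

end

end Literature.MathematicalPhysics.QuantumFieldTheory.Balaban1983to89.B6QGQCoerciveKLevelV1L3
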